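import Literature.NumberTheory.Automorphic.LangAutomorphicForms
import Literature.NumberTheory.Automorphic.CentralDerivativesTranslationGLComponents
import Literature.NumberTheory.Automorphic.AutomorphicRepDataSplitCenter
import Literature.NumberTheory.Automorphic.LocalComponentBJExistsProofs
import Literature.NumberTheory.Automorphic.AutomorphicRepsGLCuspidalSpectralSupport
import Literature.NumberTheory.Automorphic.AdelicGLnGlueProofs
import Literature.RepresentationTheory.CompactGroups.FiniteDimensionalSemisimple
import HarnessLib

/-!
# Automorphic representations of `GL_n(𝔸_K)` are admissible, from Harish-Chandra's finiteness
# theorem — proofs for `LangAutomorphicForms` (Borel–Jacquet 1979, 4.5–4.6)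

Topic `NumberTheory/Automorphic`; second sibling proof file of `LangAutomorphicForms` (next to
`LangAutomorphicFormsProofs`, which treats `harishChandra_finiteness`/`cuspForm_bounded`), concerning
its named fact `automorphicRep_isAdmissible hcpt` (Borel–Jacquet, Corvallis 1979, 4.5 and 4.6): for every
automorphic representation datum `π = W / W'` of `GL_n(𝔸_K)` (an irreducible
`(𝔤, K_∞) × GL_n(𝔸_K^∞)`-stable subquotient of the space of automorphic forms), the action of
`GL_n(𝔸_K^∞)` on `W / W'` is smooth and, for every level `U`, the `K_∞`-module `(W / W')^U` has
finite `K_∞`-multiplicities. In print this is a consequence of Harish-Chandra's finiteness theorem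
(Borel–Jacquet 4.3 (i); Harish-Chandra, LNM 62, Thm. 1), which the tree carries as the (unproved)
named fact `harishChandra_finiteness hcpt` of the same file. This file proves everything else:

* `AutomorphicRepData.isSmooth_finiteRep_gl` (**proved, unconditional**): the first clause — the
  `GL_n(𝔸_K^∞)`-action on `W / W'` is smooth (every automorphic form is fixed by `{1} × U₀`, `U₀`
  open in `GL_n(𝔸_K^∞)`, which is open in `G(𝔸_f) = {1} × GL_n(𝔸_K^∞)` by continuity of the
  finite-part projection; Borel–Jacquet 4.3, "as a `G(𝔸_f)`-module `𝒜` is smooth").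
* `automorphicRep_isAdmissible_of_harishChandra_finiteness` (**proved**):
  `harishChandra_finiteness hcpt → automorphicRep_isAdmissible hcpt`, i.e. Borel–Jacquet 4.5–4.6
  for `GL_n` reduced exactly to 4.3 (i), as in print. The discharge
  `automorphicRep_isAdmissible_holds` thus waits only on Harish-Chandra's finiteness theorem
  (reduction theory), not restated here.
* `automorphicRep_isAdmissible_of_harishChandra_finiteness_gl` (**proved**, §§10–14):
  `harishChandra_finiteness_gl hcpt → automorphicRep_isAdmissible hcpt` — the same conclusion from the
  CHARACTER form of Borel–Jacquet 4.3 (i) (`AutomorphicRepsGL.harishChandra_finiteness_gl`: forms of a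
  level, a `Z(𝔤)`-character `θ` and finitely many `K_∞`-types span a finite-dimensional space), which
  is the weaker of the two named forms of Harish-Chandra's theorem in the tree (the ideal form implies
  it, `harishChandra_finiteness_gl_of_harishChandra_finiteness` of `LangAutomorphicFormsProofs`) and the
  hypothesis `hfin`/`hHC` of the cuspidal-admissibility files. So the discharge of
  `automorphicRep_isAdmissible` waits only on `harishChandra_finiteness_gl`.

## The proof of the second clause (Borel–Jacquet 4.5, "in view of 4.5" of 4.6)

Let `π = W / W'`, `U` a level, `τ` an irreducible finite-dimensional representation of `K_∞`.

1. (`AutomorphicRepData.exists_annihilated_stable_gl`, §5.) Pick `φ₀ ∈ W ∖ W'`; the span `E` of its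
   `K_∞`-translates is finite-dimensional (`K_∞`-finiteness), and its annihilator `J ≤ Z(𝔤)` is an
   ideal of finite codimension (`exists_ideal_annihilator_gl`, §4: `Z(𝔤) / J` embeds in the product
   of the `Z(𝔤)`-orbit spans of finitely many generators) which is `Ad(K_∞)`-stable because `E` is
   `K_∞`-stable — this replaces Borel–Jacquet's appeal to the finiteness of `π₀(K_∞)`. The space
   `V = {ψ ∈ W | J ψ = 0}` is `(𝔤, K_∞) × G(𝔸_f)`-stable (`Z(𝔤)` commutes with `G(𝔸_f)` and `𝔤`,
   and with `K_∞` up to `Ad`), and `V + W'` is stable and contains `φ₀ ∉ W'`, so `W = V + W'` by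
   irreducibility.
2. (`AutomorphicRepData.exists_surjective_intertwiningMap_kRepFixed_gl`, §7, with the averaging
   lemma `AutomorphicRepData.exists_rightInvariant_lift_gl`, §3.) Every `U`-fixed class is `[v]`,
   `v ∈ V`, and averaging `v` over the finitely many cosets of its stabiliser in the compact `U`
   gives a `U`-invariant `ψ ∈ V` with `[ψ] = [v]`: the `K_∞`-map `S = V ∩ 𝒜^U → (W / W')^U` is onto.
3. (`isSemisimpleRepresentation_kinf_gl`, §6.) `K_∞` acts completely reducibly on `S`: the action is
   locally finite (`K_∞`-finiteness) and weakly continuous (automorphic forms are continuous on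
   `GL_n(𝔸_K)`), and `K_∞` is compact, so Weyl's unitarian trick applies (the tree's
   `Literature.RepresentationTheory.CompactGroups.isSemisimpleRepresentation_of_locallyFinite_of_continuous`;
   Knapp–Vogan 1995, Prop. 1.18 (b)). Hence every `K_∞`-map `τ → (W / W')^U` lifts to `S`
   (`Representation.IntertwiningMap.exists_comp_eq_of_isSemisimpleRepresentation`, §2).
4. (`exists_finiteDimensional_forall_intertwiningMap_mem_gl`, §8.) The values of a `K_∞`-map
   `τ → S` are automorphic forms of level `U`, killed by `J`, all of whose `K_∞`-slices are matrix
   coefficients of `τ`: they span a finite-dimensional space by `harishChandra_finiteness hcpt`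
   (through `harishChandra_finiteness.apply_gl`, the fact spelled with the datum's objects).
5. (`Representation.finiteDimensional_intertwiningMap_of_surjective`, §2, and the assembly §9.) So
   `Hom_{K_∞}(τ, (W / W')^U)` embeds in `Hom(τ, B)` for a finite-dimensional `B`.

Everything here is proved: theorems only, no definition, no new named fact, no `sorry`.

## From the character form (§§10–14)

With only `harishChandra_finiteness_gl` (finiteness for a fixed `Z(𝔤)`-CHARACTER rather than a
finite-codimensional ideal `J`), step 4 is replaced as follows; steps 1–3 and 5 are unchanged.

* (§12, `exists_mem_iSup_range_coe_eq_applyFree_gl`.) The `τ`-isotypic part `S_τ = ∑_{f'} im f'` of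
  `S = V ∩ 𝒜^U` (sum over all `K_∞`-maps `f' : τ → S`) is stable under `Z(𝔤)`: a central word `p`
  preserves `V` (stability under `𝔤`) and `𝒜^U` (`p` commutes with `G(𝔸_f)`), is additive on smooth
  functions, and commutes with `r(k)` for EVERY `k ∈ K_∞` — all connected components — by the tree's
  `applyFree_archTranslate_of_isCentralWord` (`CentralDerivativesTranslationGLComponents`: `Z(𝔤)` is
  `Ad(GL_n(K_∞))`-invariant), so `p ∘ f'` is again a `K_∞`-map (`exists_intertwiningMap_coe_eq_applyFree_gl`).
* (§§10–11, pure linear algebra.) `Z(𝔤)` acts on `S_τ` through the finite-dimensional commutative real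
  algebra `Z(𝔤) ⧸ J`. `finiteDimensional_of_forall_character`: if a commutative real algebra `Z` acts on a
  complex space, `J ≤ Z` has finite codimension, and `F` is a `Z`-stable subspace killed by `J` all of
  whose CHARACTER subspaces (where `Z` acts through some `θ : Z →ₐ[ℝ] ℂ`) are finite-dimensional, then
  `F` is finite-dimensional — lift a real basis of `Z ⧸ J` to commuting operators, algebraic since
  `Z ⧸ J` is finite-dimensional (`exists_polynomial_ne_zero_aeval_mem`), whose joint eigenspaces are
  character subspaces; one algebraic operator with finite-dimensional eigenspaces on a subspace killed by
  `q(a) ≠ 0` gives a finite-dimensional subspace by induction on `deg q` and rank–nullity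
  (`finiteDimensional_of_aeval_apply_eq_zero`, `finiteDimensional_of_forall_joint_eigenspace`). This is
  the passage "we may assume `J` is the kernel of a character" of the proof of Borel–Jacquet 4.3 (i),
  carried out inside `W` (where `Z(𝔤)`-stability is part of the datum) rather than on all of `𝒜`.
* (§13, `finiteDimensional_of_forall_hasZCharacter_gl`,
  `exists_finiteDimensional_forall_intertwiningMap_mem_gl_of_character`.) A character subspace of `S_τ`
  consists of automorphic forms of level `U`, `Z(𝔤)`-character `θ` and `K_∞`-slices among the matrix
  coefficients of `τ` (`slice_mem_coeffSpace_of_mem_iSup_range_gl`), hence is finite-dimensional by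
  `harishChandra_finiteness_gl`; so `S_τ` is finite-dimensional and contains the values of every `f'`.
* (§14.) Assembly as in §9: `AutomorphicRepData.isAdmissibleGK_kRepFixed_gl_of_harishChandra_finiteness_gl`,
  `automorphicRep_isAdmissible_of_harishChandra_finiteness_gl`.

## Design notes

* The smoothness clause and steps 1–3, 5 are unconditional; only step 4 consumes `hHC`.
* Engineering (recorded because it shapes the file): elaboration in the context of the honest
  `GL_n` datum is fragile — `rcases`/`obtain` after certain steps, new local instances (`haveI`),
  and statements mixing differently synthesised algebra instances on `Z(𝔤) = centerU (AutomorphyDatum.gl n K hcpt).arch`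
  (a subalgebra of a `RingQuot`) all lead to `whnf`/`isDefEq` time-outs. Hence existentials are
  opened with `Exists.elim`, finiteness hypotheses are passed explicitly, intermediate objects
  (`J`, `V`, the linear maps) are produced by small top-level lemmas and kept opaque, the
  finite-codimension statement is proved for a generic commutative real algebra
  (`finiteDimensional_quotient_ideal_of_forall_mem_iff`), and all archimedean objects are spelled
  through `AutomorphyDatum.gl n K hcpt` (not `archGroupGL n K` / `Kinf n K`, which are only
  definitionally equal) except in the one bridge `harishChandra_finiteness.apply_gl`.
* (§13) For the same reason the action `Z(𝔤) →ₐ[ℝ] End(archSmooth)` (`envelopingAction ∘ val`), the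
  image of `S_τ` in the function space and its preimage in `archSmooth` are introduced through
  existentials carrying exactly the properties used (membership, the word action on central words,
  transport of finiteness), no local instance is ever added (`Module.Finite.equiv`/`of_injective` with
  the finiteness passed explicitly), and scalar identities on `archSmooth` are closed by `congrArg
  Subtype.val` rather than by rewriting with `Submodule.coe_smul`.
* `(H5)` `open scoped Classical`; no local notation and no local instance (the archimedean objects are
  always reached through the datum, whose types carry their instances).

## References

* A. Borel, H. Jacquet, *Automorphic forms and automorphic representations*, Proc. Sympos. Pure
  Math. 33 (Corvallis 1977), Part 1 (1979), 189–202, 4.2, 4.3 (i)–(ii), 4.5, 4.6 [BorelJacquet1979]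
  (doi:10.1090/pspum/033.1/546598; not held — paywalled, acquisition requested; statements as
  vendored in `LangAutomorphicForms` / `AutomorphicForms`).
* J. R. Getz, H. Hahn, *An Introduction to Automorphic Representations*, GTM 300 (2024), Thm. 6.1
  (p. 118: "`𝒜(J)` is an admissible `(𝔤, K_∞) × G(𝔸_F^∞)`-module", proof through Harish-Chandra's
  finiteness theorem Thm. 4.4.1) and Def. 6.6 [GetzHahn2024] (held).
* Harish-Chandra, *Automorphic forms on semisimple Lie groups*, LNM 62 (1968), Thm. 1.
* A. W. Knapp, D. A. Vogan, *Cohomological Induction and Unitary Representations* (1995),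
  Prop. 1.18 [KnappVogan1995] (held).
-/

open scoped MatrixGroups Matrix ContDiff Classical
open NumberField NumberField.mixedEmbedding IsDedekindDomain

noncomputable section

namespace Literature.NumberTheory.Automorphic

/-! ### 1. The `GL_n(𝔸_K^∞)`-action on `W / W'` is smooth -/

section Smooth

variable {n : ℕ} {K : Type} [Field K] [NumberField K] {hcpt : isCompact_glFiniteIntegralLevel n K}

/-- Every element of the space of automorphic forms of `GL_n` is a smooth vector for right
translation restricted to `G(𝔸_f) = {1} × GL_n(𝔸_K^∞)` (with its topology induced from
`GL_n(𝔸_K)`): it is fixed by `{1} × U₀` for an open `U₀ ≤ GL_n(𝔸_K^∞)`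
(`exists_isOpen_forall_rightTranslation_ofFinite_eq`), and `{1} × U₀` is open in `G(𝔸_f)`, being
the preimage of `U₀` under the continuous finite-part projection `GLn.sndHom`.
Borel–Jacquet 1979, 4.2 (a) and 4.3. [cite: BorelJacquet1979, 4.3] -/
theorem isSmoothVector_finiteAdelic_gl {φ : (AdelicGroupData.gl n K).Adelic → ℂ}
    (hφ : φ ∈ automorphicForms (AutomorphyDatum.gl n K hcpt)) :
    Representation.IsSmoothVector
      (MonoidHom.comp (rightTranslation (AdelicGroupData.gl n K))
        (AutomorphyDatum.gl n K hcpt).finiteAdelic.subtype :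
        Representation ℂ (AutomorphyDatum.gl n K hcpt).finiteAdelic
          ((AdelicGroupData.gl n K).Adelic → ℂ)) φ := by
  obtain ⟨U₀, hU₀, hfix⟩ := exists_isOpen_forall_rightTranslation_ofFinite_eq hφ
  -- the open subgroup `{1} × U₀` of `G(𝔸_f)`
  let V₀ : Subgroup (AutomorphyDatum.gl n K hcpt).finiteAdelic :=
    U₀.comap ((GLn.sndHom n K).comp (AutomorphyDatum.gl n K hcpt).finiteAdelic.subtype)
  have hV₀ : IsOpen (V₀ : Set (AutomorphyDatum.gl n K hcpt).finiteAdelic) :=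
    hU₀.preimage ((GLn.continuous_sndHom (n := n) (K := K)).comp continuous_subtype_val)
  refine Representation.isSmoothVector_of_le _ hV₀ fun x hx ↦ ?_
  rw [Representation.mem_stabilizerSubgroup]
  obtain ⟨u, hu⟩ : ∃ u, GLn.ofFinite n K u = (x : (AdelicGroupData.gl n K).Adelic) := x.2
  have hux : GLn.sndHom n K (x : (AdelicGroupData.gl n K).Adelic) = u := by
    rw [← hu, GLn.sndHom_ofFinite]
  have huU : u ∈ U₀ := by
    have hx' : GLn.sndHom n K (x : (AdelicGroupData.gl n K).Adelic) ∈ U₀ := hx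
    rwa [hux] at hx'
  change rightTranslation (AdelicGroupData.gl n K) (x : (AdelicGroupData.gl n K).Adelic) φ = φ
  rw [← hu]
  exact hfix u huU

/-- **The `GL_n(𝔸_K^∞)`-action on an automorphic representation `W / W'` of `GL_n(𝔸_K)` is
smooth** (first clause of `automorphicRep_isAdmissible`; Borel–Jacquet 1979, 4.3: "as a
`G(𝔸_f)`-module `𝒜` is smooth", and 4.6): the stabiliser of `[φ]`, `φ ∈ W`, contains the open
stabiliser of `φ` (`isSmoothVector_finiteAdelic_gl`). [cite: BorelJacquet1979, 4.6] -/
theorem AutomorphicRepData.isSmooth_finiteRep_gl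
    (π : AutomorphicRepData (AutomorphyDatum.gl n K hcpt)) : π.finiteRep.IsSmooth := by
  intro v
  induction v using Submodule.Quotient.induction_on with
  | H φ =>
    refine π.finiteRep.isSmoothVector_of_le
      (isSmoothVector_finiteAdelic_gl (π.stable.le_automorphicForms φ.2)) fun u hu ↦ ?_
    simp only [Representation.mem_stabilizerSubgroup] at hu ⊢
    rw [AutomorphicRepData.finiteRep_mk]
    congr 1
    exact Subtype.ext hu

end Smooth

/-! ### 2. Abstract representation theory: lifting `K`-maps through a semisimple cover -/

section Abstract

variable {k G S Q T : Type*} [Field k] [Group G] [AddCommGroup S] [Module k S]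
  [AddCommGroup Q] [Module k Q] [AddCommGroup T] [Module k T]
  {σ : Representation k G S} {κ : Representation k G Q} {τ : Representation k G T}

/-- **`K`-maps into a quotient of a completely reducible representation lift.** Let `Φ : σ → κ`
be a surjective `G`-map from a completely reducible representation `σ`. Then every `G`-map
`f : τ → κ` factors as `f = Φ ∘ f'` for a `G`-map `f' : τ → σ`: an invariant complement `C` of
`ker Φ` maps isomorphically onto `κ`, and `f' = (Φ|_C)⁻¹ ∘ f`. (Knapp–Vogan 1995, Prop. 1.18:
locally finite representations of a compact group are completely reducible, so that `Hom_K(τ, ·)`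
is exact on them.) [folklore] -/
theorem Representation.IntertwiningMap.exists_comp_eq_of_isSemisimpleRepresentation
    [σ.IsSemisimpleRepresentation] (Φ : σ.IntertwiningMap κ) (hΦ : Function.Surjective Φ)
    (f : τ.IntertwiningMap κ) : ∃ f' : τ.IntertwiningMap σ, ∀ t, Φ (f' t) = f t := by
  obtain ⟨C, hC⟩ := exists_isCompl Φ.ker
  -- `Φ` restricted to the complement `C` is a linear isomorphism onto `Q`
  let ΦC : C.toSubmodule →ₗ[k] Q := Φ.toLinearMap ∘ₗ C.toSubmodule.subtype
  have hinj : Function.Injective ΦC := by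
    intro x y hxy
    have hxy' : (x : S) - y ∈ Φ.ker := by
      rw [Representation.IntertwiningMap.mem_ker, map_sub, sub_eq_zero]
      exact hxy
    have hmem : (x : S) - y ∈ (Φ.ker ⊓ C : Subrepresentation σ) :=
      ⟨hxy', C.toSubmodule.sub_mem x.2 y.2⟩
    rw [hC.inf_eq_bot] at hmem
    have h0 : (x : S) - y = 0 := hmem
    exact Subtype.ext (sub_eq_zero.1 h0)
  have hsurj : Function.Surjective ΦC := by
    intro q
    obtain ⟨s, rfl⟩ := hΦ q
    have hs : s ∈ (Φ.ker ⊔ C : Subrepresentation σ) := by rw [hC.sup_eq_top]; trivial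
    rw [← SetLike.mem_coe, Subrepresentation.coe_sup] at hs
    obtain ⟨a, ha, c, hc, rfl⟩ := hs
    refine ⟨⟨c, hc⟩, ?_⟩
    change Φ c = Φ (a + c)
    rw [map_add, (Representation.IntertwiningMap.mem_ker _ _ Φ a).1 ha, zero_add]
  let e : C.toSubmodule ≃ₗ[k] Q := LinearEquiv.ofBijective ΦC ⟨hinj, hsurj⟩
  have he : ∀ c : C.toSubmodule, Φ (c : S) = e c := fun c ↦ rfl
  -- the lift
  refine ⟨⟨C.toSubmodule.subtype ∘ₗ (e.symm : Q →ₗ[k] C.toSubmodule) ∘ₗ f.toLinearMap,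
    fun g ↦ ?_⟩, fun t ↦ ?_⟩
  · refine LinearMap.ext fun t ↦ ?_
    simp only [LinearMap.coe_comp, Function.comp_apply, Submodule.coe_subtype,
      Representation.IntertwiningMap.toLinearMap_apply, LinearEquiv.coe_coe]
    -- both sides lie in `C`; compare their images under `Φ`
    have hmemC : σ g ((e.symm (f t) : C.toSubmodule) : S) ∈ C :=
      C.apply_mem_toSubmodule g (e.symm (f t)).2
    have key : e ⟨σ g ((e.symm (f t) : C.toSubmodule) : S), hmemC⟩ = e (e.symm (f (τ g t))) := by
      rw [LinearEquiv.apply_symm_apply, ← he]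
      change Φ (σ g ((e.symm (f t) : C.toSubmodule) : S)) = f (τ g t)
      rw [Representation.IntertwiningMap.isIntertwining σ κ Φ g, he, LinearEquiv.apply_symm_apply,
        Representation.IntertwiningMap.isIntertwining τ κ f g]
    have key' := e.injective key
    rw [← key']
  · change Φ ((e.symm (f t) : C.toSubmodule) : S) = f t
    rw [he, LinearEquiv.apply_symm_apply]

/-- **Finite multiplicities descend along a surjection from a completely reducible
representation, given a finite-dimensional bound on the lifts.** With `Φ : σ → κ` surjective,
`σ` completely reducible and `T` finite-dimensional: if all `G`-maps `τ → σ` take values in one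
finite-dimensional subspace `A ≤ S`, then `Hom_G(τ, κ)` is finite-dimensional (every `f : τ → κ`
is `Φ ∘ f'`, so takes values in `Φ(A)`, and `f ↦ f` is an injective linear map into
`Hom(T, Φ(A))`). [folklore] -/
theorem Representation.finiteDimensional_intertwiningMap_of_surjective
    [σ.IsSemisimpleRepresentation] [FiniteDimensional k T] (Φ : σ.IntertwiningMap κ)
    (hΦ : Function.Surjective Φ) (A : Submodule k S) [FiniteDimensional k A]
    (hA : ∀ f' : τ.IntertwiningMap σ, ∀ t, f' t ∈ A) :
    FiniteDimensional k (τ.IntertwiningMap κ) := by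
  let B : Submodule k Q := A.map Φ.toLinearMap
  haveI : FiniteDimensional k B := inferInstance
  have hrange : ∀ (f : τ.IntertwiningMap κ) (t : T), f t ∈ B := by
    intro f t
    obtain ⟨f', hf'⟩ :=
      Representation.IntertwiningMap.exists_comp_eq_of_isSemisimpleRepresentation Φ hΦ f
    exact ⟨f' t, hA f' t, hf' t⟩
  let L : τ.IntertwiningMap κ →ₗ[k] (T →ₗ[k] B) :=
    { toFun := fun f ↦ LinearMap.codRestrict B f.toLinearMap (hrange f)
      map_add' := fun f g ↦ LinearMap.ext fun t ↦ Subtype.ext rfl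
      map_smul' := fun c f ↦ LinearMap.ext fun t ↦ Subtype.ext rfl }
  refine Module.Finite.of_injective L fun f g hfg ↦ ?_
  refine Representation.IntertwiningMap.ext (LinearMap.ext fun t ↦ ?_)
  have h := congrArg (fun F : T →ₗ[k] B ↦ ((F t : B) : Q)) hfg
  exact h

end Abstract

/-! ### 3. Averaging over a level: `U`-fixed vectors of `W / W'` lift to `U`-invariant forms -/

section Averaging

variable {n : ℕ} {K : Type} [Field K] [NumberField K] {hcpt : isCompact_glFiniteIntegralLevel n K}

/-- A level `U = {1} × U₀ ∈ finiteLevelsGL n K`, seen inside `G(𝔸_f) = {1} × GL_n(𝔸_K^∞)` (with the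
topology induced from `GL_n(𝔸_K)`), is compact: it is the image of the compact `U₀` under the
continuous `GLn.ofFinite`. Borel–Jacquet 1979, 4.1. [cite: BorelJacquet1979, 4.1] -/
theorem isCompact_subgroupOf_finiteAdelic_of_mem_finiteLevelsGL
    {U : Subgroup (GL (Fin n) (AdeleRing (𝓞 K) K))} (hU : U ∈ finiteLevelsGL n K) :
    IsCompact (SetLike.coe (U.subgroupOf (AutomorphyDatum.gl n K hcpt).finiteAdelic)) := by
  obtain ⟨U₀, -, hU₀cpt, rfl⟩ := hU
  let j : GL (Fin n) (FiniteAdeleRing (𝓞 K) K) → (AutomorphyDatum.gl n K hcpt).finiteAdelic :=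
    fun u ↦ ⟨GLn.ofFinite n K u, ⟨u, rfl⟩⟩
  have hj : Continuous j := (GLn.continuous_ofFinite n K).subtype_mk _
  have himage : SetLike.coe ((U₀.map (GLn.ofFinite n K)).subgroupOf (AutomorphyDatum.gl n K hcpt).finiteAdelic) =
      j '' (U₀ : Set (GL (Fin n) (FiniteAdeleRing (𝓞 K) K))) := by
    refine Set.ext fun x ↦ ⟨fun h ↦ ?_, fun h ↦ ?_⟩
    · obtain ⟨u, hu, hux⟩ := Subgroup.mem_map.1 (Subgroup.mem_subgroupOf.1 h)
      exact ⟨u, hu, Subtype.ext hux⟩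
    · obtain ⟨u, hu, rfl⟩ := h
      exact Subgroup.mem_subgroupOf.2 (Subgroup.mem_map.2 ⟨u, hu, rfl⟩)
  rw [himage]
  exact hU₀cpt.image hj

/-- **Averaging over a level.** Let `π = W / W'` be an automorphic representation of `GL_n(𝔸_K)`,
`U` a level, `V ≤ W` a subspace stable under right translation by `G(𝔸_f)`, and `v ∈ V` whose
class `[v]` is `U`-fixed. Then `[v] = [ψ]` for some `U`-invariant `ψ ∈ V`: `v` is fixed by a
subgroup `N` of finite index of the compact `U` (its stabiliser is open), and
`ψ = [U : N]⁻¹ ∑_{c ∈ U/N} r(c) v` is `U`-invariant with class `[U : N]⁻¹ ∑_c r(c) [v] = [v]`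
(Borel–Jacquet 1979, 4.5: "a `U`-fixed vector of `W / W'` lifts to `W^U`"; Bushnell–Henniart 2006,
§4.2, the idempotent `e_U`). [cite: BorelJacquet1979, 4.5] -/
theorem AutomorphicRepData.exists_rightInvariant_lift_gl
    (π : AutomorphicRepData (AutomorphyDatum.gl n K hcpt))
    {U : Subgroup (GL (Fin n) (AdeleRing (𝓞 K) K))} (hU : U ∈ finiteLevelsGL n K)
    {V : Submodule ℂ ((AdelicGroupData.gl n K).Adelic → ℂ)} (hVW : V ≤ π.W)
    (hVf : ∀ h ∈ (AutomorphyDatum.gl n K hcpt).finiteAdelic,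
      V ≤ V.comap (rightTranslation (AdelicGroupData.gl n K) h))
    {v : (AdelicGroupData.gl n K).Adelic → ℂ} (hv : v ∈ V)
    (hq : π.mkQ ⟨v, hVW hv⟩ ∈
      π.finiteRep.fixedPoints (U.subgroupOf (AutomorphyDatum.gl n K hcpt).finiteAdelic)) :
    ∃ ψ, ∃ hψ : ψ ∈ V, ψ ∈ (rightTranslation (AdelicGroupData.gl n K)).fixedPoints U ∧
      π.mkQ ⟨ψ, hVW hψ⟩ = π.mkQ ⟨v, hVW hv⟩ := by
  set U' : Subgroup (AutomorphyDatum.gl n K hcpt).finiteAdelic :=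
    U.subgroupOf (AutomorphyDatum.gl n K hcpt).finiteAdelic with hU'_def
  have hU'cpt : IsCompact (U' : Set (AutomorphyDatum.gl n K hcpt).finiteAdelic) :=
    isCompact_subgroupOf_finiteAdelic_of_mem_finiteLevelsGL hU
  -- `v` is a smooth vector of `W`
  have hsm : π.finiteRepW.IsSmoothVector (⟨v, hVW hv⟩ : π.W) := by
    refine π.finiteRepW.isSmoothVector_of_le
      (isSmoothVector_finiteAdelic_gl (π.stable.le_automorphicForms (hVW hv))) fun u hu ↦ ?_
    simp only [Representation.mem_stabilizerSubgroup] at hu ⊢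
    exact Subtype.ext hu
  obtain ⟨N, hNfi, hNfix⟩ :=
    exists_finiteIndex_forall_apply_eq_of_isSmoothVector π.finiteRepW U' hU'cpt hsm
  haveI := hNfi
  haveI : Fintype (U' ⧸ N) := Fintype.ofFinite _
  -- the sum of the translates over `U' / N`
  set ψW : π.W := (∑ᶠ c : U' ⧸ N, π.finiteRepW ((c.out : U') : (AutomorphyDatum.gl n K hcpt).finiteAdelic))
    ⟨v, hVW hv⟩ with hψW_def
  have hψW_fix : ψW ∈ π.finiteRepW.fixedPoints U' :=
    subgroupQuotientSum_apply_mem_fixedPoints_of_forall π.finiteRepW U' N hNfix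
  have hψW_V : ψW ∈ V.comap π.W.subtype := by
    refine subgroupQuotientSum_apply_mem π.finiteRepW U' N (W := V.comap π.W.subtype) ?_ hv
    intro g hg w hw
    exact hVf _ g.2 hw
  -- its class is `[U' : N] • [v]`
  have hclass : π.mkQ ψW = (Fintype.card (U' ⧸ N) : ℂ) • π.mkQ ⟨v, hVW hv⟩ := by
    rw [hψW_def, finsum_eq_sum_of_fintype, LinearMap.sum_apply, map_sum]
    have hterm : ∀ c : U' ⧸ N,
        π.mkQ (π.finiteRepW ((c.out : U') : (AutomorphyDatum.gl n K hcpt).finiteAdelic) ⟨v, hVW hv⟩) =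
          π.mkQ ⟨v, hVW hv⟩ := by
      intro c
      have h1 : π.mkQ (π.finiteRepW ((c.out : U') : (AutomorphyDatum.gl n K hcpt).finiteAdelic) ⟨v, hVW hv⟩) =
          π.finiteRep ((c.out : U') : (AutomorphyDatum.gl n K hcpt).finiteAdelic) (π.mkQ ⟨v, hVW hv⟩) := rfl
      rw [h1]
      exact (π.finiteRep.mem_fixedPoints U' _).1 hq _ (c.out : U').2
    rw [Finset.sum_congr rfl fun c _ ↦ hterm c, Finset.sum_const, Finset.card_univ, ← Nat.cast_smul_eq_nsmul ℂ]
  have hcard : (Fintype.card (U' ⧸ N) : ℂ) ≠ 0 := Nat.cast_ne_zero.2 Fintype.card_ne_zero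
  -- the average
  refine ⟨(Fintype.card (U' ⧸ N) : ℂ)⁻¹ • (ψW : (AdelicGroupData.gl n K).Adelic → ℂ),
    V.smul_mem _ hψW_V, ?_, ?_⟩
  · rw [Representation.mem_fixedPoints]
    intro u hu
    have hu' : (⟨u, (AutomorphyDatum.gl n K hcpt).le_finiteAdelic U hU hu⟩ :
        (AutomorphyDatum.gl n K hcpt).finiteAdelic) ∈ U' := Subgroup.mem_subgroupOf.2 hu
    have hfixu := (π.finiteRepW.mem_fixedPoints U' ψW).1 hψW_fix _ hu'
    have hfixu' : rightTranslation (AdelicGroupData.gl n K) u (ψW : (AdelicGroupData.gl n K).Adelic → ℂ) = ψW :=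
      congrArg Subtype.val hfixu
    rw [map_smul, hfixu']
  · have hmk : π.mkQ ⟨(Fintype.card (U' ⧸ N) : ℂ)⁻¹ • (ψW : (AdelicGroupData.gl n K).Adelic → ℂ),
        hVW (V.smul_mem _ hψW_V)⟩ = (Fintype.card (U' ⧸ N) : ℂ)⁻¹ • π.mkQ ψW := by
      rw [← map_smul]
      rfl
    rw [hmk, hclass, inv_smul_smul₀ hcard]

end Averaging

/-! ### 4. The annihilator in `Z(𝔤)` of a finite-dimensional `K_∞`-stable space of forms -/

section GenericQuotient

variable {R : Type*} [CommRing R] [Algebra ℝ R] {M : Type*} [AddCommGroup M] [Module ℝ M]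

/-- **An ideal which is the kernel of a real linear map into a finite-dimensional space has finite
codimension**: for an ideal `J` of a commutative real algebra `R` with `J = ker Λ` (as sets) for a
real linear `Λ : R → M`, `M` finite-dimensional, `R / J` is finite-dimensional (`R / J ≅ R / ker Λ ↪ M`).
Stated for a generic algebra: the instances on the concrete `Z(𝔤)` are too expensive to unfold in the
middle of this argument. [folklore] -/
theorem finiteDimensional_quotient_ideal_of_forall_mem_iff [FiniteDimensional ℝ M] (Λ : R →ₗ[ℝ] M)
    (J : Ideal R) (hJ : ∀ z, z ∈ J ↔ Λ z = 0) : FiniteDimensional ℝ (R ⧸ J) := by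
  have hker : J.restrictScalars ℝ = LinearMap.ker Λ := by
    ext z
    rw [Submodule.restrictScalars_mem, LinearMap.mem_ker, hJ]
  have hinj : Function.Injective ((LinearMap.ker Λ).liftQ Λ le_rfl) :=
    LinearMap.ker_eq_bot.mp (Submodule.ker_liftQ_eq_bot _ _ _ le_rfl)
  haveI : FiniteDimensional ℝ (R ⧸ LinearMap.ker Λ) := FiniteDimensional.of_injective _ hinj
  haveI : FiniteDimensional ℝ (R ⧸ J.restrictScalars ℝ) := by rwa [hker]
  exact LinearEquiv.finiteDimensional (Submodule.Quotient.restrictScalarsEquiv ℝ J)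

end GenericQuotient

section Annihilator

variable {n : ℕ} {K : Type} [Field K] [NumberField K] {hcpt : isCompact_glFiniteIntegralLevel n K}


/-- The evaluation of `Z(𝔤)` on a smooth function is compatible with products:
`z · φ = 0 → (c z) · φ = 0` (`(c z) · φ = c · (z · φ)` through central words,
`applyFree_mul_apply_of_isArchSmooth`);
so the annihilator `{z | z · φ = 0}` of `φ` in `Z(𝔤)` is an ideal. Borel–Jacquet 1979, §1.6. [folklore] -/
theorem centralEval_mul_eq_zero {φ : (AdelicGroupData.gl n K).Adelic → ℂ} (hφ : IsArchSmooth (AutomorphyDatum.gl n K hcpt).ofArch φ)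
    (c z : centerU (AutomorphyDatum.gl n K hcpt).arch) (hz : centralEval hφ z = 0) : centralEval hφ (c * z) = 0 := by
  obtain ⟨q, hq, rfl⟩ := exists_isCentralWord_freeToEnveloping_eq _ c
  obtain ⟨r, hr, rfl⟩ := exists_isCentralWord_freeToEnveloping_eq _ z
  have hqr : IsCentralWord (q * r) := by
    unfold IsCentralWord
    rw [map_mul]
    exact Subalgebra.mul_mem _ hq hr
  have hprod : ((⟨freeToEnveloping _ q, hq⟩ : centerU (AutomorphyDatum.gl n K hcpt).arch) * ⟨freeToEnveloping _ r, hr⟩) =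
      ⟨freeToEnveloping _ (q * r), hqr⟩ :=
    Subtype.ext (map_mul (freeToEnveloping _) q r).symm
  rw [hprod, centralEval_mk hφ (q * r) hqr,
    applyFree_mul_apply_of_isArchSmooth (AutomorphyDatum.gl n K hcpt).ofArch q r hφ, ← centralEval_mk hφ r hr, hz]
  exact applyFree_zero_right _ q

/-- The common annihilator in `Z(𝔤)` of finitely many smooth functions on `GL_n(𝔸_K)` is an ideal
(`centralEval_mul_eq_zero`). Borel–Jacquet 1979, §1.6 and 4.5. [folklore] -/
theorem exists_ideal_annihilator_finset (S : Finset ((AdelicGroupData.gl n K).Adelic → ℂ))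
    (hS : ∀ e ∈ S, IsArchSmooth (AutomorphyDatum.gl n K hcpt).ofArch e) :
    ∃ J : Ideal (centerU (AutomorphyDatum.gl n K hcpt).arch), ∀ z, z ∈ J ↔ ∀ e (he : e ∈ S), centralEval (hS e he) z = 0 :=
  ⟨{ carrier := {z | ∀ e (he : e ∈ S), centralEval (hS e he) z = 0}
     zero_mem' := fun e he ↦ map_zero _
     add_mem' := fun {z z'} hz hz' e he ↦ by rw [map_add, hz e he, hz' e he, add_zero]
     smul_mem' := fun c z hz e he ↦ centralEval_mul_eq_zero _ c z (hz e he) },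
    fun z ↦ Iff.rfl⟩

/-- The evaluations `z ↦ (z · e)_{e ∈ S}` of `Z(𝔤)` on finitely many smooth functions, as one real
linear map into the product of their `Z(𝔤)`-orbit spans; its kernel is the common annihilator.
Borel–Jacquet 1979, §1.6. [folklore] -/
theorem exists_linearMap_centralEval_pi (S : Finset ((AdelicGroupData.gl n K).Adelic → ℂ))
    (hS : ∀ e ∈ S, IsArchSmooth (AutomorphyDatum.gl n K hcpt).ofArch e) :
    ∃ Λ : centerU (AutomorphyDatum.gl n K hcpt).arch →ₗ[ℝ] ((e : S) → zOrbitSpan (AutomorphyDatum.gl n K hcpt).ofArch (e : (AdelicGroupData.gl n K).Adelic → ℂ)),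
      ∀ z, Λ z = 0 ↔ ∀ e (he : e ∈ S), centralEval (hS e he) z = 0 :=
  ⟨{ toFun := fun z e ↦ ⟨centralEval (hS _ e.2) z, centralEval_mem_zOrbitSpan _ z⟩
     map_add' := fun z z' ↦ funext fun _ ↦ Subtype.ext (map_add (centralEval _) z z')
     map_smul' := fun r z ↦ funext fun _ ↦ Subtype.ext (LinearMap.map_smul (centralEval _) r z) },
    fun _ ↦ ⟨fun h e he ↦ congrArg Subtype.val (congrFun h ⟨e, he⟩),
      fun h ↦ funext fun e ↦ Subtype.ext (h e e.2)⟩⟩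

/-- **The common annihilator of finitely many `Z(𝔤)`-finite smooth functions has finite codimension
in `Z(𝔤)`**: `Z(𝔤) / J` embeds (by `z ↦ (z · e)_e`) into the product of the finite-dimensional
`Z(𝔤)`-orbit spans of the functions. Borel–Jacquet 1979, §1.6 and 4.3 (i), 4.5. [cite: BorelJacquet1979, 4.5] -/
theorem finiteDimensional_quotient_annihilator_finset (S : Finset ((AdelicGroupData.gl n K).Adelic → ℂ))
    (hS : ∀ e ∈ S, IsArchSmooth (AutomorphyDatum.gl n K hcpt).ofArch e) (hZ : ∀ e ∈ S, IsZFinite (AutomorphyDatum.gl n K hcpt).ofArch e)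
    (J : Ideal (centerU (AutomorphyDatum.gl n K hcpt).arch))
    (hJ : ∀ z, z ∈ J ↔ ∀ e (he : e ∈ S), centralEval (hS e he) z = 0) :
    FiniteDimensional ℝ (centerU (AutomorphyDatum.gl n K hcpt).arch ⧸ J) := by
  haveI hfinOrb : ∀ e : S, FiniteDimensional ℂ (zOrbitSpan (AutomorphyDatum.gl n K hcpt).ofArch (e : (AdelicGroupData.gl n K).Adelic → ℂ)) :=
    fun e ↦ hZ _ e.2
  haveI hfinOrbR : ∀ e : S, Module.Finite ℝ (zOrbitSpan (AutomorphyDatum.gl n K hcpt).ofArch (e : (AdelicGroupData.gl n K).Adelic → ℂ)) :=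
    fun e ↦ Module.Finite.trans ℂ _
  refine (exists_linearMap_centralEval_pi S hS).elim fun Λ hΛ ↦ ?_
  exact finiteDimensional_quotient_ideal_of_forall_mem_iff Λ J fun z ↦ (hJ z).trans (hΛ z).symm

/-- **The annihilator ideal.** Let `E` be a finite-dimensional space of functions on `GL_n(𝔸_K)`
which are smooth in the archimedean variable and `Z(𝔤)`-finite, stable under right translation by
`K_∞`. Then there is an ideal `J ≤ Z(𝔤)` of finite codimension killing `E` — precisely: a central
word `p` maps into `J` iff `p ψ = 0` for all `ψ ∈ E` — which is moreover stable under `Ad(K_∞)` in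
the form consumed by `applyFree_archTranslate`: with `p` also `Ad(k)⁻¹ · p` maps into `J`
(because `E` is `K_∞`-stable: `p (r(k) ψ) = r(k) ((Ad(k)⁻¹ · p) ψ)`). `J` is the common annihilator
of finitely many `Z(𝔤)`-finite functions spanning `E` (`exists_ideal_annihilator_finset`,
`finiteDimensional_quotient_annihilator_finset`). This is the ideal "`J`, which may be assumed
`Ad(K_∞)`-stable" of the proof of Borel–Jacquet 1979, 4.5 (there obtained from the finiteness of the
component group of `K_∞`; here from the `K_∞`-finiteness of automorphic forms). [cite: BorelJacquet1979, 4.5] -/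
theorem exists_ideal_annihilator_gl (E : Submodule ℂ ((AdelicGroupData.gl n K).Adelic → ℂ)) (hE : FiniteDimensional ℂ E)
    (hEs : ∀ ψ ∈ E, IsArchSmooth (AutomorphyDatum.gl n K hcpt).ofArch ψ) (hEz : ∀ ψ ∈ E, IsZFinite (AutomorphyDatum.gl n K hcpt).ofArch ψ)
    (hEk : ∀ k : (AutomorphyDatum.gl n K hcpt).arch.maximalCompact, ∀ ψ ∈ E, rightTranslation (AdelicGroupData.gl n K) ((AutomorphyDatum.gl n K hcpt).ofK k) ψ ∈ E) :
    ∃ J : Ideal (centerU (AutomorphyDatum.gl n K hcpt).arch),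
      FiniteDimensional ℝ (centerU (AutomorphyDatum.gl n K hcpt).arch ⧸ J) ∧
      (∀ (p : FreeAlgebra ℝ (AutomorphyDatum.gl n K hcpt).arch.lie) (hp : IsCentralWord p),
        (⟨freeToEnveloping (AutomorphyDatum.gl n K hcpt).arch p, hp⟩ : centerU (AutomorphyDatum.gl n K hcpt).arch) ∈ J ↔
          ∀ ψ ∈ E, applyFree (AutomorphyDatum.gl n K hcpt).ofArch p ψ = 0) ∧
      (∀ (k : (AutomorphyDatum.gl n K hcpt).arch.maximalCompact) (p : FreeAlgebra ℝ (AutomorphyDatum.gl n K hcpt).arch.lie) (hp : IsCentralWord p),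
        (⟨freeToEnveloping (AutomorphyDatum.gl n K hcpt).arch p, hp⟩ : centerU (AutomorphyDatum.gl n K hcpt).arch) ∈ J →
        (⟨freeToEnveloping (AutomorphyDatum.gl n K hcpt).arch (FreeAlgebra.lift ℝ (FreeAlgebra.ι ℝ ∘ (AutomorphyDatum.gl n K hcpt).arch.Ad
              (Subgroup.inclusion (AutomorphyDatum.gl n K hcpt).arch.maximalCompact_le_carrier k)⁻¹) p),
          isCentralWord_lift_Ad _ hp⟩ : centerU (AutomorphyDatum.gl n K hcpt).arch) ∈ J) := by
  -- a finite spanning set of `E` (`Exists.elim` rather than `obtain`, which is pathologically slow here)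
  refine ((Submodule.fg_iff_finiteDimensional E).2 hE).elim fun s hs ↦ ?_
  have hsE : ∀ e ∈ s, (e : (AdelicGroupData.gl n K).Adelic → ℂ) ∈ E := fun e he ↦ hs.le (Submodule.subset_span he)
  have hsS : ∀ e ∈ s, IsArchSmooth (AutomorphyDatum.gl n K hcpt).ofArch e := fun e he ↦ hEs e (hsE e he)
  refine (exists_ideal_annihilator_finset s hsS).elim fun J hJmem ↦ ?_
  have hJfin : FiniteDimensional ℝ (centerU (AutomorphyDatum.gl n K hcpt).arch ⧸ J) :=
    finiteDimensional_quotient_annihilator_finset s hsS (fun e he ↦ hEz e (hsE e he)) J hJmem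
  -- membership of central words: killing `E`
  have hJword : ∀ (p : FreeAlgebra ℝ (AutomorphyDatum.gl n K hcpt).arch.lie) (hp : IsCentralWord p),
      (⟨freeToEnveloping (AutomorphyDatum.gl n K hcpt).arch p, hp⟩ : centerU (AutomorphyDatum.gl n K hcpt).arch) ∈ J ↔
        ∀ ψ ∈ E, applyFree (AutomorphyDatum.gl n K hcpt).ofArch p ψ = 0 := by
    intro p hp
    rw [hJmem]
    constructor
    · intro h ψ hψ
      have key : ∀ x ∈ Submodule.span ℂ (s : Set ((AdelicGroupData.gl n K).Adelic → ℂ)), applyFree (AutomorphyDatum.gl n K hcpt).ofArch p x = 0 := by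
        intro x hx
        induction hx using Submodule.span_induction with
        | mem e he =>
          rw [← centralEval_mk (hsS e he) p hp]
          exact h e he
        | zero => exact applyFree_zero_right _ p
        | add x y hx hy hx' hy' =>
          rw [applyFree_add_right_of_top (AutomorphyDatum.gl n K hcpt).ofArch (archGroupGL_lie n K) (archGroupGL_carrier n K) p
            (hEs _ (hs.le hx)) (hEs _ (hs.le hy)), hx', hy', add_zero]
        | smul c x hx hx' => rw [applyFree_smul_right, hx', smul_zero]
      exact key ψ (hs.ge hψ)
    · intro h e he
      rw [centralEval_mk (hsS e he) p hp]
      exact h e (hsE e he)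
  refine ⟨J, hJfin, hJword, fun k p hp hpJ ↦ ?_⟩
  -- `Ad(K_∞)`-stability: `0 = p (r(k) ψ) = r(k) ((Ad(k)⁻¹ · p) ψ)`
  rw [hJword] at hpJ ⊢
  intro ψ hψ
  have hψ' : archTranslate (AutomorphyDatum.gl n K hcpt).ofArch (Subgroup.inclusion (AutomorphyDatum.gl n K hcpt).arch.maximalCompact_le_carrier k) ψ ∈ E :=
    hEk k ψ hψ
  have h0 := hpJ _ hψ'
  rw [applyFree_archTranslate] at h0
  have h1 := congrArg (archTranslate (AutomorphyDatum.gl n K hcpt).ofArch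
    (Subgroup.inclusion (AutomorphyDatum.gl n K hcpt).arch.maximalCompact_le_carrier k)⁻¹) h0
  rwa [map_zero, ← Module.End.mul_apply, ← map_mul, inv_mul_cancel, map_one,
    Module.End.one_apply] at h1

end Annihilator

/-! ### 5. The `(𝔤, K_∞) × G(𝔸_f)`-stable subspace killed by `J`; `W = V + W'` by irreducibility -/

section Stable

variable {n : ℕ} {K : Type} [Field K] [NumberField K] {hcpt : isCompact_glFiniteIntegralLevel n K}


/-- **The heart of Borel–Jacquet 4.5 for an irreducible subquotient `W / W'`.** There are an ideal
`J ≤ Z(𝔤)` of finite codimension and a `(𝔤, K_∞) × G(𝔸_f)`-stable subspace `V ≤ W` all of whose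
elements are killed by `J`, with `W = V + W'`: take `φ₀ ∈ W ∖ W'`, `J` the (`Ad(K_∞)`-stable,
finite-codimensional) annihilator of the span of the `K_∞`-translates of `φ₀`
(`exists_ideal_annihilator_gl`) and `V = {ψ ∈ W | J ψ = 0}`; `V` is stable because `Z(𝔤)` commutes
with `G(𝔸_f)` (`applyFree_comp_mul_right`), with `𝔤` (`applyFree_lieDeriv_of_isCentralWord`) and,
up to `Ad`, with `K_∞` (`applyFree_archTranslate`), and `V + W'` is a stable subspace containing
`φ₀ ∉ W'`, hence all of `W` (`π.irreducible`). Borel–Jacquet 1979, 4.5 ("`{ψ ∈ W | J ψ = 0} + W'`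
is stable and `≠ W'`") and 4.6. [cite: BorelJacquet1979, 4.5] -/
theorem AutomorphicRepData.exists_annihilated_stable_gl (π : AutomorphicRepData (AutomorphyDatum.gl n K hcpt)) :
    ∃ (J : Ideal (centerU (AutomorphyDatum.gl n K hcpt).arch)) (V : Submodule ℂ ((AdelicGroupData.gl n K).Adelic → ℂ)),
      FiniteDimensional ℝ (centerU (AutomorphyDatum.gl n K hcpt).arch ⧸ J) ∧ V ≤ π.W ∧ IsStableSubmodule (AutomorphyDatum.gl n K hcpt) V ∧
      (∀ ψ ∈ V, ∀ (p : FreeAlgebra ℝ (AutomorphyDatum.gl n K hcpt).arch.lie) (hp : IsCentralWord p),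
        (⟨freeToEnveloping (AutomorphyDatum.gl n K hcpt).arch p, hp⟩ : centerU (AutomorphyDatum.gl n K hcpt).arch) ∈ J → applyFree (AutomorphyDatum.gl n K hcpt).ofArch p ψ = 0) ∧
      π.W ≤ V ⊔ π.W' := by
  have hH : (AutomorphyDatum.gl n K hcpt).arch.lie = ⊤ := archGroupGL_lie n K
  have hc : (AutomorphyDatum.gl n K hcpt).arch.carrier = ⊤ := archGroupGL_carrier n K
  refine (SetLike.exists_of_lt π.lt).elim fun φ₀ hφ₀ ↦ ?_
  have hφ₀W : φ₀ ∈ π.W := hφ₀.1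
  have hφ₀W' : φ₀ ∉ π.W' := hφ₀.2
  -- the span `E` of the `K_∞`-translates of `φ₀`
  -- (no `haveI`: a new local instance invalidates the instance cache and the re-synthesis of the
  -- analytic instances on `mixedSpace K` then times out — finiteness is passed explicitly)
  have hEfin : FiniteDimensional ℂ (kTranslateSpan (AutomorphyDatum.gl n K hcpt).ofArch φ₀) := π.stable.isKFinite hφ₀W
  have hEW : kTranslateSpan (AutomorphyDatum.gl n K hcpt).ofArch φ₀ ≤ π.W := Submodule.span_le.2 (by
    rintro _ ⟨k, rfl⟩
    exact π.stable.k_stable k hφ₀W)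
  have hEs : ∀ ψ ∈ kTranslateSpan (AutomorphyDatum.gl n K hcpt).ofArch φ₀, IsArchSmooth (AutomorphyDatum.gl n K hcpt).ofArch ψ :=
    fun ψ hψ ↦ π.stable.isArchSmooth (hEW hψ)
  have hEz : ∀ ψ ∈ kTranslateSpan (AutomorphyDatum.gl n K hcpt).ofArch φ₀, IsZFinite (AutomorphyDatum.gl n K hcpt).ofArch ψ := fun ψ hψ ↦
    (isAutomorphicForm_of_mem_automorphicForms_gl (π.stable.le_automorphicForms (hEW hψ))).zFinite
  have hEk : ∀ k : (AutomorphyDatum.gl n K hcpt).arch.maximalCompact, ∀ ψ ∈ kTranslateSpan (AutomorphyDatum.gl n K hcpt).ofArch φ₀,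
      rightTranslation (AdelicGroupData.gl n K) ((AutomorphyDatum.gl n K hcpt).ofK k) ψ ∈ kTranslateSpan (AutomorphyDatum.gl n K hcpt).ofArch φ₀ :=
    fun k ψ hψ ↦ archTranslate_mem_kTranslateSpan_of_mem (AutomorphyDatum.gl n K hcpt).ofArch k hψ
  have hφ₀E : φ₀ ∈ kTranslateSpan (AutomorphyDatum.gl n K hcpt).ofArch φ₀ := by
    have h1 : archTranslate (AutomorphyDatum.gl n K hcpt).ofArch (Subgroup.inclusion (AutomorphyDatum.gl n K hcpt).arch.maximalCompact_le_carrier 1) φ₀ = φ₀ := by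
      rw [map_one, map_one, Module.End.one_apply]
    exact Submodule.subset_span ⟨1, h1⟩
  -- the annihilator `J`
  refine (exists_ideal_annihilator_gl (kTranslateSpan (AutomorphyDatum.gl n K hcpt).ofArch φ₀) hEfin hEs hEz hEk).elim
    fun J hJ ↦ ?_
  have hJfin := hJ.1
  have hJword := hJ.2.1
  have hJAd := hJ.2.2
  -- the subspace `V = {ψ ∈ W | J ψ = 0}` (kept opaque)
  have hVex : ∃ V : Submodule ℂ ((AdelicGroupData.gl n K).Adelic → ℂ), ∀ ψ, ψ ∈ V ↔
      (ψ ∈ π.W ∧ ∀ (p : FreeAlgebra ℝ (AutomorphyDatum.gl n K hcpt).arch.lie) (hp : IsCentralWord p),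
        (⟨freeToEnveloping (AutomorphyDatum.gl n K hcpt).arch p, hp⟩ : centerU (AutomorphyDatum.gl n K hcpt).arch) ∈ J → applyFree (AutomorphyDatum.gl n K hcpt).ofArch p ψ = 0) :=
    ⟨{ carrier := {ψ | ψ ∈ π.W ∧ ∀ (p : FreeAlgebra ℝ (AutomorphyDatum.gl n K hcpt).arch.lie) (hp : IsCentralWord p),
          (⟨freeToEnveloping (AutomorphyDatum.gl n K hcpt).arch p, hp⟩ : centerU (AutomorphyDatum.gl n K hcpt).arch) ∈ J → applyFree (AutomorphyDatum.gl n K hcpt).ofArch p ψ = 0}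
       zero_mem' := ⟨zero_mem _, fun p _ _ ↦ applyFree_zero_right _ p⟩
       add_mem' := fun {a b} ha hb ↦ ⟨add_mem ha.1 hb.1, fun p hp hpJ ↦ by
         rw [applyFree_add_right_of_top (AutomorphyDatum.gl n K hcpt).ofArch hH hc p (π.stable.isArchSmooth ha.1)
           (π.stable.isArchSmooth hb.1), ha.2 p hp hpJ, hb.2 p hp hpJ, add_zero]⟩
       smul_mem' := fun c a ha ↦ ⟨Submodule.smul_mem _ c ha.1, fun p hp hpJ ↦ by
         rw [applyFree_smul_right, ha.2 p hp hpJ, smul_zero]⟩ },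
      fun ψ ↦ Iff.rfl⟩
  refine hVex.elim fun V hV ↦ ?_
  have hVW : V ≤ π.W := fun ψ hψ ↦ ((hV ψ).1 hψ).1
  have hVJ : ∀ ψ ∈ V, ∀ (p : FreeAlgebra ℝ (AutomorphyDatum.gl n K hcpt).arch.lie) (hp : IsCentralWord p),
      (⟨freeToEnveloping (AutomorphyDatum.gl n K hcpt).arch p, hp⟩ : centerU (AutomorphyDatum.gl n K hcpt).arch) ∈ J → applyFree (AutomorphyDatum.gl n K hcpt).ofArch p ψ = 0 :=
    fun ψ hψ ↦ ((hV ψ).1 hψ).2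
  -- stability of `V`
  have hVst : IsStableSubmodule (AutomorphyDatum.gl n K hcpt) V :=
    { le_automorphicForms := hVW.trans π.stable.le_automorphicForms
      finite_stable := fun h hh ψ hψ ↦ by
        rw [Submodule.mem_comap, hV]
        refine ⟨π.stable.finite_stable h hh (hVW hψ), fun p hp hpJ ↦ ?_⟩
        have hcomm : ∀ a : (AutomorphyDatum.gl n K hcpt).arch.carrier, (AutomorphyDatum.gl n K hcpt).ofArch a * h = h * (AutomorphyDatum.gl n K hcpt).ofArch a :=
          fun a ↦ (AutomorphyDatum.gl n K hcpt).commute_ofArch a h hh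
        have key := applyFree_comp_mul_right (AutomorphyDatum.gl n K hcpt).ofArch p ψ hcomm
        rw [hVJ ψ hψ p hp hpJ] at key
        rw [show rightTranslation (AdelicGroupData.gl n K) h ψ = fun g ↦ ψ (g * h) from rfl, key]
        rfl
      k_stable := fun k ψ hψ ↦ by
        rw [Submodule.mem_comap, hV]
        refine ⟨π.stable.k_stable k (hVW hψ), fun p hp hpJ ↦ ?_⟩
        rw [← AutomorphyDatum.archTranslate_ofK, applyFree_archTranslate,
          hVJ ψ hψ _ (isCentralWord_lift_Ad _ hp) (hJAd k p hp hpJ), map_zero]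
      lie_stable := fun X ψ hψ ↦ by
        rw [hV]
        refine ⟨π.stable.lie_stable X ψ (hVW hψ), fun p hp hpJ ↦ ?_⟩
        rw [applyFree_lieDeriv_of_isCentralWord hH hc hp X (π.stable.isArchSmooth (hVW hψ)),
          hVJ ψ hψ p hp hpJ]
        exact lieDeriv_zero_right _ X }
  have hφ₀V : φ₀ ∈ V := (hV φ₀).2 ⟨hφ₀W, fun p hp hpJ ↦ (hJword p hp).1 hpJ φ₀ hφ₀E⟩
  -- `V + W'` is stable, contains `φ₀ ∉ W'`, hence equals `W`
  have hsup : IsStableSubmodule (AutomorphyDatum.gl n K hcpt) (V ⊔ π.W') := hVst.sup π.stable'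
  exact (π.irreducible (V ⊔ π.W') le_sup_right (sup_le hVW π.lt.le) hsup).elim
    (fun h ↦ absurd (h.le (Submodule.mem_sup_left hφ₀V)) hφ₀W')
    (fun h ↦ ⟨J, V, hJfin, hVW, hVst, hVJ, h.ge⟩)

end Stable

/-! ### 6. `K_∞` on a `K_∞`-stable space of automorphic forms: locally finite, continuous, semisimple -/

section KAction

variable {n : ℕ} {K : Type} [Field K] [NumberField K] {hcpt : isCompact_glFiniteIntegralLevel n K}


/-! In this section `S` is a space of automorphic forms on `GL_n(𝔸_K)` and `ρ` a representation of
`K_∞` on `S` acting by right translation (hypothesis `hρ`; e.g. `Representation.subrepresentation` of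
`r ∘ ofK` on a `K_∞`-stable `S`). -/

/-- **Orbits are finite-dimensional**: the `K_∞`-orbit of an element of `S` spans a
finite-dimensional space (`K_∞`-finiteness of automorphic forms, Borel–Jacquet 1979, 4.2 (b)). [cite: BorelJacquet1979, 4.2] -/
theorem finiteDimensional_span_orbit_kinf_gl (S : Submodule ℂ ((AdelicGroupData.gl n K).Adelic → ℂ))
    (hSA : S ≤ automorphicForms (AutomorphyDatum.gl n K hcpt)) (ρ : Representation ℂ (AutomorphyDatum.gl n K hcpt).arch.maximalCompact S)
    (hρ : ∀ (k : (AutomorphyDatum.gl n K hcpt).arch.maximalCompact) (v : S),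
      ((ρ k v : S) : (AdelicGroupData.gl n K).Adelic → ℂ) = rightTranslation (AdelicGroupData.gl n K) ((AutomorphyDatum.gl n K hcpt).ofK k) v) (v : S) :
    FiniteDimensional ℂ (Submodule.span ℂ (Set.range fun k : (AutomorphyDatum.gl n K hcpt).arch.maximalCompact ↦ ρ k v)) := by
  haveI : FiniteDimensional ℂ (kTranslateSpan (AutomorphyDatum.gl n K hcpt).ofArch (v : (AdelicGroupData.gl n K).Adelic → ℂ)) :=
    (isAutomorphicForm_of_mem_automorphicForms_gl (hSA v.2)).kFinite
  have hle : (Submodule.span ℂ (Set.range fun k : (AutomorphyDatum.gl n K hcpt).arch.maximalCompact ↦ ρ k v)).map S.subtype ≤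
      kTranslateSpan (AutomorphyDatum.gl n K hcpt).ofArch (v : (AdelicGroupData.gl n K).Adelic → ℂ) := by
    rw [Submodule.map_span]
    refine Submodule.span_le.2 ?_
    rintro _ ⟨_, ⟨k, rfl⟩, rfl⟩
    rw [SetLike.mem_coe, Submodule.subtype_apply, hρ, ← AutomorphyDatum.archTranslate_ofK]
    exact archTranslate_mem_kTranslateSpan (AutomorphyDatum.gl n K hcpt).ofArch k _
  haveI : FiniteDimensional ℂ
      ((Submodule.span ℂ (Set.range fun k : (AutomorphyDatum.gl n K hcpt).arch.maximalCompact ↦ ρ k v)).map S.subtype) :=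
    Submodule.finiteDimensional_of_le hle
  exact LinearEquiv.finiteDimensional
    (Submodule.equivMapOfInjective S.subtype S.injective_subtype _).symm

/-- **Matrix coefficients are continuous**: for `v ∈ S` and any linear form `ℓ` on `S`,
`k ↦ ℓ (ρ(k) v)` is continuous on `K_∞` — the orbit `k ↦ r(k) v` is continuous into the
finite-dimensional span of the orbit with its function-space topology (automorphic forms are
continuous on `GL_n(𝔸_K)`, `IsAutomorphicForm.continuous_gl`), on which `ℓ` is continuous.
Borel–Jacquet 1979, 4.2 and §1.3 (continuity of the `K`-action on `K`-finite smooth functions). [cite: BorelJacquet1979, 4.2] -/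
theorem continuous_apply_orbit_kinf_gl (S : Submodule ℂ ((AdelicGroupData.gl n K).Adelic → ℂ))
    (hSA : S ≤ automorphicForms (AutomorphyDatum.gl n K hcpt)) (ρ : Representation ℂ (AutomorphyDatum.gl n K hcpt).arch.maximalCompact S)
    (hρ : ∀ (k : (AutomorphyDatum.gl n K hcpt).arch.maximalCompact) (v : S),
      ((ρ k v : S) : (AdelicGroupData.gl n K).Adelic → ℂ) = rightTranslation (AdelicGroupData.gl n K) ((AutomorphyDatum.gl n K hcpt).ofK k) v)
    (v : S) (ℓ : Module.Dual ℂ S) :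
    Continuous fun k : (AutomorphyDatum.gl n K hcpt).arch.maximalCompact ↦ ℓ (ρ k v) := by
  haveI := finiteDimensional_span_orbit_kinf_gl S hSA ρ hρ v
  -- the orbit map into the (finite-dimensional) span of the orbit is continuous
  have hofK : Continuous (AutomorphyDatum.gl n K hcpt).ofK :=
    (AutomorphyDatum.gl n K hcpt).continuous_ofArch.comp (continuous_induced_rng.2 continuous_subtype_val)
  have hv : Continuous (v : (AdelicGroupData.gl n K).Adelic → ℂ) :=
    (isAutomorphicForm_of_mem_automorphicForms_gl (hSA v.2)).continuous_gl
  have hfun : (fun k : (AutomorphyDatum.gl n K hcpt).arch.maximalCompact ↦ ((ρ k v : S) : (AdelicGroupData.gl n K).Adelic → ℂ)) =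
      fun k g ↦ (v : (AdelicGroupData.gl n K).Adelic → ℂ) (g * (AutomorphyDatum.gl n K hcpt).ofK k) := by
    funext k
    rw [hρ]
    rfl
  have h2 : Continuous fun k : (AutomorphyDatum.gl n K hcpt).arch.maximalCompact ↦ ((ρ k v : S) : (AdelicGroupData.gl n K).Adelic → ℂ) := by
    rw [hfun]
    exact continuous_pi fun g ↦ hv.comp (continuous_const.mul hofK)
  have h3 : Continuous fun k : (AutomorphyDatum.gl n K hcpt).arch.maximalCompact ↦ (ρ k v : S) := continuous_induced_rng.2 h2
  have horbit : Continuous fun k : (AutomorphyDatum.gl n K hcpt).arch.maximalCompact ↦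
      (⟨ρ k v, Submodule.subset_span ⟨k, rfl⟩⟩ :
        Submodule.span ℂ (Set.range fun k : (AutomorphyDatum.gl n K hcpt).arch.maximalCompact ↦ ρ k v)) :=
    h3.subtype_mk _
  let L : Submodule.span ℂ (Set.range fun k : (AutomorphyDatum.gl n K hcpt).arch.maximalCompact ↦ ρ k v) →ₗ[ℂ] ℂ :=
    ℓ ∘ₗ (Submodule.span ℂ (Set.range fun k : (AutomorphyDatum.gl n K hcpt).arch.maximalCompact ↦ ρ k v)).subtype
  have hℓ : Continuous L :=
    @LinearMap.continuous_of_finiteDimensional ℂ inferInstance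
      (Submodule.span ℂ (Set.range fun k : (AutomorphyDatum.gl n K hcpt).arch.maximalCompact ↦ ρ k v))
      inferInstance inferInstance inferInstance inferInstance inferInstance
      ℂ inferInstance inferInstance inferInstance inferInstance inferInstance
      inferInstance inferInstance inferInstance L
  exact hℓ.comp horbit

/-- **The `K_∞`-action on a `K_∞`-stable space of automorphic forms is completely reducible**:
it is locally finite (`finiteDimensional_span_orbit_kinf_gl`) and weakly continuous
(`continuous_apply_orbit_kinf_gl`), and `K_∞` is compact (`isCompact_Kinf_holds`), so Weyl's
unitarian trick applies
(`Literature.RepresentationTheory.CompactGroups.isSemisimpleRepresentation_of_locallyFinite_of_continuous`;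
Knapp–Vogan 1995, Prop. 1.18 (b)). [cite: KnappVogan1995, Prop. 1.18] -/
theorem isSemisimpleRepresentation_kinf_gl (S : Submodule ℂ ((AdelicGroupData.gl n K).Adelic → ℂ))
    (hSA : S ≤ automorphicForms (AutomorphyDatum.gl n K hcpt)) (ρ : Representation ℂ (AutomorphyDatum.gl n K hcpt).arch.maximalCompact S)
    (hρ : ∀ (k : (AutomorphyDatum.gl n K hcpt).arch.maximalCompact) (v : S),
      ((ρ k v : S) : (AdelicGroupData.gl n K).Adelic → ℂ) = rightTranslation (AdelicGroupData.gl n K) ((AutomorphyDatum.gl n K hcpt).ofK k) v) :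
    ρ.IsSemisimpleRepresentation := by
  haveI : CompactSpace (AutomorphyDatum.gl n K hcpt).arch.maximalCompact :=
    isCompact_iff_compactSpace.mp (isCompact_Kinf_holds n K)
  exact Literature.RepresentationTheory.CompactGroups.isSemisimpleRepresentation_of_locallyFinite_of_continuous
    ρ (finiteDimensional_span_orbit_kinf_gl S hSA ρ hρ) (continuous_apply_orbit_kinf_gl S hSA ρ hρ)

end KAction

/-! ### 7. The `K_∞`-map `V^U → (W / W')^U` and its surjectivity -/

section Surjection

variable {n : ℕ} {K : Type} [Field K] [NumberField K] {hcpt : isCompact_glFiniteIntegralLevel n K}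


/-- The `U`-invariant functions are stable under right translation by `K_∞` (which centralises the
level `U ≤ G(𝔸_f)`). Borel–Jacquet 1979, 4.3 (ii). [cite: BorelJacquet1979, 4.3] -/
theorem fixedPoints_le_comap_rightTranslation_ofK_gl {U : Subgroup (GL (Fin n) (AdeleRing (𝓞 K) K))}
    (hU : U ∈ finiteLevelsGL n K) (k : (AutomorphyDatum.gl n K hcpt).arch.maximalCompact) :
    (rightTranslation (AdelicGroupData.gl n K)).fixedPoints U ≤
      ((rightTranslation (AdelicGroupData.gl n K)).fixedPoints U).comap (rightTranslation (AdelicGroupData.gl n K) ((AutomorphyDatum.gl n K hcpt).ofK k)) := by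
  intro ψ hψ
  rw [Submodule.mem_comap, Representation.mem_fixedPoints]
  intro u hu
  have hcomm : u * (AutomorphyDatum.gl n K hcpt).ofK k = (AutomorphyDatum.gl n K hcpt).ofK k * u :=
    ((AutomorphyDatum.gl n K hcpt).commute_ofArch _ u ((AutomorphyDatum.gl n K hcpt).le_finiteAdelic U hU hu)).symm
  rw [← Module.End.mul_apply, ← map_mul, hcomm, map_mul, Module.End.mul_apply]
  exact congrArg _ ((Representation.mem_fixedPoints _ U ψ).1 hψ u hu)

/-- **The `K_∞`-map `S = V ∩ 𝒜^U → (W / W')^U`, `ψ ↦ [ψ]`, and its surjectivity.** Let `π = W / W'`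
be an automorphic representation of `GL_n(𝔸_K)`, `U` a level and `V ≤ W` a
`(𝔤, K_∞) × G(𝔸_f)`-stable subspace with `W = V + W'`. On the `K_∞`-stable space `S` of `U`-invariant
elements of `V`, with its `K_∞`-action `ρ` by right translation, `ψ ↦ [ψ]` is a `K_∞`-map onto the
`U`-fixed vectors of `W / W'`: a `U`-fixed class is `[v]` with `v ∈ V` (as `W = V + W'`), and
`[v] = [ψ]` with `ψ ∈ V` `U`-invariant by averaging over the level
(`AutomorphicRepData.exists_rightInvariant_lift_gl`). Borel–Jacquet 1979, 4.5–4.6. [cite: BorelJacquet1979, 4.5] -/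
theorem AutomorphicRepData.exists_surjective_intertwiningMap_kRepFixed_gl (π : AutomorphicRepData (AutomorphyDatum.gl n K hcpt))
    {U : Subgroup (GL (Fin n) (AdeleRing (𝓞 K) K))} (hU : U ∈ finiteLevelsGL n K)
    {V : Submodule ℂ ((AdelicGroupData.gl n K).Adelic → ℂ)} (hVW : V ≤ π.W) (hVst : IsStableSubmodule (AutomorphyDatum.gl n K hcpt) V)
    (hWle : π.W ≤ V ⊔ π.W') :
    ∃ (hS : ∀ k : (AutomorphyDatum.gl n K hcpt).arch.maximalCompact,
        V ⊓ (rightTranslation (AdelicGroupData.gl n K)).fixedPoints U ≤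
          (V ⊓ (rightTranslation (AdelicGroupData.gl n K)).fixedPoints U).comap (rightTranslation (AdelicGroupData.gl n K) ((AutomorphyDatum.gl n K hcpt).ofK k)))
      (Φ : (Representation.subrepresentation
          (MonoidHom.comp (rightTranslation (AdelicGroupData.gl n K)) (AutomorphyDatum.gl n K hcpt).ofK :
            Representation ℂ (AutomorphyDatum.gl n K hcpt).arch.maximalCompact ((AdelicGroupData.gl n K).Adelic → ℂ))
          (V ⊓ (rightTranslation (AdelicGroupData.gl n K)).fixedPoints U) hS).IntertwiningMap
        (π.kRepFixed (U.subgroupOf (AutomorphyDatum.gl n K hcpt).finiteAdelic))),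
      Function.Surjective Φ := by
  have hS : ∀ k : (AutomorphyDatum.gl n K hcpt).arch.maximalCompact,
      V ⊓ (rightTranslation (AdelicGroupData.gl n K)).fixedPoints U ≤
        (V ⊓ (rightTranslation (AdelicGroupData.gl n K)).fixedPoints U).comap (rightTranslation (AdelicGroupData.gl n K) ((AutomorphyDatum.gl n K hcpt).ofK k)) := by
    intro k
    rw [Submodule.comap_inf]
    exact inf_le_inf (hVst.k_stable k) (fixedPoints_le_comap_rightTranslation_ofK_gl hU k)
  -- the class of an element of `S` is `U`-fixed
  have hfix : ∀ ψ : ↥(V ⊓ (rightTranslation (AdelicGroupData.gl n K)).fixedPoints U),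
      π.mkQ ⟨ψ.1, hVW ψ.2.1⟩ ∈ π.finiteRep.fixedPoints (U.subgroupOf (AutomorphyDatum.gl n K hcpt).finiteAdelic) := by
    intro ψ
    rw [Representation.mem_fixedPoints]
    intro x hx
    have hx' : (x : (AdelicGroupData.gl n K).Adelic) ∈ U := Subgroup.mem_subgroupOf.1 hx
    have h1 : rightTranslation (AdelicGroupData.gl n K) (x : (AdelicGroupData.gl n K).Adelic) (ψ : (AdelicGroupData.gl n K).Adelic → ℂ) = ψ :=
      (Representation.mem_fixedPoints _ U _).1 ψ.2.2 _ hx'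
    change π.finiteRep x (Submodule.Quotient.mk _) = Submodule.Quotient.mk _
    rw [AutomorphicRepData.finiteRep_mk]
    congr 1
    exact Subtype.ext h1
  -- the linear map
  have hlin : ∃ L : ↥(V ⊓ (rightTranslation (AdelicGroupData.gl n K)).fixedPoints U) →ₗ[ℂ]
      ↥(π.finiteRep.fixedPoints (U.subgroupOf (AutomorphyDatum.gl n K hcpt).finiteAdelic)),
      ∀ ψ, (L ψ : π.Quot) = π.mkQ ⟨ψ.1, hVW ψ.2.1⟩ :=
    ⟨{ toFun := fun ψ ↦ ⟨π.mkQ ⟨ψ.1, hVW ψ.2.1⟩, hfix ψ⟩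
       map_add' := fun ψ ψ' ↦ Subtype.ext (by
         change π.mkQ _ = π.mkQ _ + π.mkQ _
         rw [← map_add]
         rfl)
       map_smul' := fun c ψ ↦ Subtype.ext (by
         change π.mkQ _ = c • π.mkQ _
         rw [← map_smul]
         rfl) }, fun ψ ↦ rfl⟩
  refine hlin.elim fun L hL ↦ ?_
  -- it intertwines the `K_∞`-actions
  have hinter : ∀ k : (AutomorphyDatum.gl n K hcpt).arch.maximalCompact,
      L ∘ₗ (Representation.subrepresentation
          (MonoidHom.comp (rightTranslation (AdelicGroupData.gl n K)) (AutomorphyDatum.gl n K hcpt).ofK :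
            Representation ℂ (AutomorphyDatum.gl n K hcpt).arch.maximalCompact ((AdelicGroupData.gl n K).Adelic → ℂ))
          (V ⊓ (rightTranslation (AdelicGroupData.gl n K)).fixedPoints U) hS k) =
        π.kRepFixed (U.subgroupOf (AutomorphyDatum.gl n K hcpt).finiteAdelic) k ∘ₗ L := by
    intro k
    refine LinearMap.ext fun ψ ↦ Subtype.ext ?_
    change (L _ : π.Quot) = π.kRep k (L ψ : π.Quot)
    rw [hL, hL]
    rfl
  refine ⟨hS, ⟨L, hinter⟩, fun q ↦ ?_⟩
  -- surjectivity
  refine (Submodule.Quotient.mk_surjective π.kerQuot (q : π.Quot)).elim fun w hw ↦ ?_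
  refine (Submodule.mem_sup.mp (hWle w.2)).elim fun v h ↦ h.elim fun hv h ↦ h.elim fun w' h ↦
    h.elim fun hw' hvw ↦ ?_
  have hq : (q : π.Quot) = π.mkQ ⟨v, hVW hv⟩ := by
    rw [← hw]
    refine (Submodule.Quotient.eq π.kerQuot).2 ?_
    change (w : (AdelicGroupData.gl n K).Adelic → ℂ) - v ∈ π.W'
    rw [← hvw, add_sub_cancel_left]
    exact hw'
  have hqfix : π.mkQ ⟨v, hVW hv⟩ ∈ π.finiteRep.fixedPoints (U.subgroupOf (AutomorphyDatum.gl n K hcpt).finiteAdelic) :=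
    hq ▸ q.2
  refine (π.exists_rightInvariant_lift_gl hU hVW hVst.finite_stable hv hqfix).elim fun ψ h ↦
    h.elim fun hψV h ↦ ?_
  refine ⟨⟨ψ, hψV, h.1⟩, Subtype.ext ?_⟩
  change (L _ : π.Quot) = q
  rw [hL, hq]
  exact h.2

end Surjection

/-! ### 8. Harish-Chandra's finiteness theorem bounds the `K_∞`-maps into `V^U` -/

section Finiteness

variable {n : ℕ} {K : Type} [Field K] [NumberField K] {hcpt : isCompact_glFiniteIntegralLevel n K}


/-- Harish-Chandra's finiteness theorem (the named fact `harishChandra_finiteness hcpt` of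
`LangAutomorphicForms`, Borel–Jacquet 1979, 4.3 (i)) spelled with the archimedean objects of the
datum `AutomorphyDatum.gl n K hcpt` (`(AutomorphyDatum.gl n K hcpt).arch = archGroupGL n K`, `(AutomorphyDatum.gl n K hcpt).arch.maximalCompact = Kinf n K`
definitionally) and with the finiteness instances as explicit hypotheses. [cite: BorelJacquet1979, 4.3 (i)] -/
theorem harishChandra_finiteness.apply_gl (hHC : harishChandra_finiteness hcpt)
    {U : Subgroup (GL (Fin n) (AdeleRing (𝓞 K) K))} (hU : U ∈ finiteLevelsGL n K)
    (J : Ideal (centerU (AutomorphyDatum.gl n K hcpt).arch)) (hJ : FiniteDimensional ℝ (centerU (AutomorphyDatum.gl n K hcpt).arch ⧸ J))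
    (M : Submodule ℂ ((AutomorphyDatum.gl n K hcpt).arch.maximalCompact → ℂ)) (hMfin : FiniteDimensional ℂ M)
    (hM : ∀ k₀ : (AutomorphyDatum.gl n K hcpt).arch.maximalCompact, ∀ f ∈ M, (fun k ↦ f (k * k₀)) ∈ M) :
    FiniteDimensional ℂ (Submodule.span ℂ
      {φ : (AdelicGroupData.gl n K).Adelic → ℂ | IsAutomorphicForm (AutomorphyDatum.gl n K hcpt) φ ∧ IsRightInvariantUnder U φ ∧
        (∀ (p : FreeAlgebra ℝ (AutomorphyDatum.gl n K hcpt).arch.lie) (hp : IsCentralWord p),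
          (⟨freeToEnveloping (AutomorphyDatum.gl n K hcpt).arch p, hp⟩ : centerU (AutomorphyDatum.gl n K hcpt).arch) ∈ J →
            applyFree (AutomorphyDatum.gl n K hcpt).ofArch p φ = 0) ∧
        ∀ g : (AdelicGroupData.gl n K).Adelic, (fun k : (AutomorphyDatum.gl n K hcpt).arch.maximalCompact ↦ φ (g * (AutomorphyDatum.gl n K hcpt).ofK k)) ∈ M}) :=
  @hHC U hU J hJ M hMfin hM

/-- **All `K_∞`-maps `τ → S = V ∩ 𝒜^U` take values in one finite-dimensional space** (for `V` killed
by an ideal `J ≤ Z(𝔤)` of finite codimension): the values of such a map `f'` are automorphic forms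
of level `U`, killed by `J`, all of whose `K_∞`-slices `k ↦ (f' t)(g k) = (f' (τ(k) t))(g)` are matrix
coefficients of `τ` (`coeffSpace`) — a finite-dimensional space by Harish-Chandra's finiteness
theorem (Borel–Jacquet 1979, 4.3 (i)), here the hypothesis `hHC`. This is the step "`A(U, J)` of
`K_∞`-type `τ` is finite-dimensional" of Borel–Jacquet 1979, 4.5. [cite: BorelJacquet1979, 4.5] -/
theorem exists_finiteDimensional_forall_intertwiningMap_mem_gl (hHC : harishChandra_finiteness hcpt)
    {U : Subgroup (GL (Fin n) (AdeleRing (𝓞 K) K))} (hU : U ∈ finiteLevelsGL n K)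
    {V : Submodule ℂ ((AdelicGroupData.gl n K).Adelic → ℂ)} (hVA : V ≤ automorphicForms (AutomorphyDatum.gl n K hcpt))
    (J : Ideal (centerU (AutomorphyDatum.gl n K hcpt).arch)) (hJfin : FiniteDimensional ℝ (centerU (AutomorphyDatum.gl n K hcpt).arch ⧸ J))
    (hVJ : ∀ ψ ∈ V, ∀ (p : FreeAlgebra ℝ (AutomorphyDatum.gl n K hcpt).arch.lie) (hp : IsCentralWord p),
      (⟨freeToEnveloping (AutomorphyDatum.gl n K hcpt).arch p, hp⟩ : centerU (AutomorphyDatum.gl n K hcpt).arch) ∈ J → applyFree (AutomorphyDatum.gl n K hcpt).ofArch p ψ = 0)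
    (ρ : Representation ℂ (AutomorphyDatum.gl n K hcpt).arch.maximalCompact ↥(V ⊓ (rightTranslation (AdelicGroupData.gl n K)).fixedPoints U))
    (hρ : ∀ (k : (AutomorphyDatum.gl n K hcpt).arch.maximalCompact) (v : ↥(V ⊓ (rightTranslation (AdelicGroupData.gl n K)).fixedPoints U)),
      ((ρ k v : ↥(V ⊓ (rightTranslation (AdelicGroupData.gl n K)).fixedPoints U)) : (AdelicGroupData.gl n K).Adelic → ℂ) =
        rightTranslation (AdelicGroupData.gl n K) ((AutomorphyDatum.gl n K hcpt).ofK k) v)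
    {T : Type} [AddCommGroup T] [Module ℂ T] [FiniteDimensional ℂ T]
    (τ : Representation ℂ (AutomorphyDatum.gl n K hcpt).arch.maximalCompact T) :
    ∃ A : Submodule ℂ ↥(V ⊓ (rightTranslation (AdelicGroupData.gl n K)).fixedPoints U), FiniteDimensional ℂ A ∧
      ∀ f' : τ.IntertwiningMap ρ, ∀ t, f' t ∈ A := by
  -- the space of matrix coefficients of `τ`
  have hM : ∀ k₀ : (AutomorphyDatum.gl n K hcpt).arch.maximalCompact, ∀ f ∈ coeffSpace (fun k ↦ (τ k : T →ₗ[ℂ] T)),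
      (fun k ↦ f (k * k₀)) ∈ coeffSpace (fun k ↦ (τ k : T →ₗ[ℂ] T)) :=
    fun k₀ f hf ↦ comp_mul_right_mem_coeffSpace (fun k k' ↦ map_mul τ k k') k₀ hf
  have hfin := harishChandra_finiteness.apply_gl hHC hU J hJfin
    (coeffSpace (fun k ↦ (τ k : T →ₗ[ℂ] T))) (finiteDimensional_coeffSpace _) hM
  -- name the span bounded by `hHC` (kept opaque, with its defining equation)
  have hAex : ∃ A : Submodule ℂ ((AdelicGroupData.gl n K).Adelic → ℂ), A = Submodule.span ℂ
      {φ : (AdelicGroupData.gl n K).Adelic → ℂ | IsAutomorphicForm (AutomorphyDatum.gl n K hcpt) φ ∧ IsRightInvariantUnder U φ ∧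
        (∀ (p : FreeAlgebra ℝ (AutomorphyDatum.gl n K hcpt).arch.lie) (hp : IsCentralWord p),
          (⟨freeToEnveloping (AutomorphyDatum.gl n K hcpt).arch p, hp⟩ : centerU (AutomorphyDatum.gl n K hcpt).arch) ∈ J →
            applyFree (AutomorphyDatum.gl n K hcpt).ofArch p φ = 0) ∧
        ∀ g : (AdelicGroupData.gl n K).Adelic, (fun k : (AutomorphyDatum.gl n K hcpt).arch.maximalCompact ↦ φ (g * (AutomorphyDatum.gl n K hcpt).ofK k)) ∈
          coeffSpace (fun k ↦ (τ k : T →ₗ[ℂ] T))} := ⟨_, rfl⟩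
  refine hAex.elim fun A hA ↦ ?_
  have hAfin : FiniteDimensional ℂ A := by
    rw [hA]
    exact hfin
  refine ⟨A.comap (V ⊓ (rightTranslation (AdelicGroupData.gl n K)).fixedPoints U).subtype, ?_, fun f' t ↦ ?_⟩
  · -- finite-dimensional: it embeds in `A`
    haveI := hAfin
    exact FiniteDimensional.of_injective
      (((V ⊓ (rightTranslation (AdelicGroupData.gl n K)).fixedPoints U).subtype).restrict
        (p := A.comap (V ⊓ (rightTranslation (AdelicGroupData.gl n K)).fixedPoints U).subtype) (q := A) fun x hx ↦ hx)
      fun x y hxy ↦ Subtype.ext (Subtype.ext (congrArg (fun z : A ↦ (z : (AdelicGroupData.gl n K).Adelic → ℂ)) hxy))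
  · -- the values of a `K_∞`-map lie in it
    rw [Submodule.mem_comap, hA]
    refine Submodule.subset_span ⟨isAutomorphicForm_of_mem_automorphicForms_gl (hVA (f' t).2.1),
      fun u hu g ↦ congrFun ((Representation.mem_fixedPoints _ U _).1 (f' t).2.2 u hu) g,
      fun p hp hpJ ↦ hVJ _ (f' t).2.1 p hp hpJ, fun g ↦ ?_⟩
    have hslice : (fun k : (AutomorphyDatum.gl n K hcpt).arch.maximalCompact ↦
        ((f' t : ↥(V ⊓ (rightTranslation (AdelicGroupData.gl n K)).fixedPoints U)) : (AdelicGroupData.gl n K).Adelic → ℂ) (g * (AutomorphyDatum.gl n K hcpt).ofK k)) =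
        fun k ↦ ((LinearMap.proj g : ((AdelicGroupData.gl n K).Adelic → ℂ) →ₗ[ℂ] ℂ) ∘ₗ
          (V ⊓ (rightTranslation (AdelicGroupData.gl n K)).fixedPoints U).subtype ∘ₗ f'.toLinearMap) (τ k t) := by
      funext k
      change _ = ((f' (τ k t) : ↥(V ⊓ (rightTranslation (AdelicGroupData.gl n K)).fixedPoints U)) : (AdelicGroupData.gl n K).Adelic → ℂ) g
      rw [Representation.IntertwiningMap.isIntertwining τ ρ f' k t, hρ]
      rfl
    exact (congrArg (· ∈ coeffSpace (fun k ↦ (τ k : T →ₗ[ℂ] T))) hslice).mpr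
      (coeff_mem_coeffSpace _ _ t)

end Finiteness

/-! ### 9. Assembly: automorphic representations of `GL_n(𝔸_K)` are admissible, from
Harish-Chandra's finiteness theorem -/

section Assembly

variable {n : ℕ} {K : Type} [Field K] [NumberField K] {hcpt : isCompact_glFiniteIntegralLevel n K}


/-- **Borel–Jacquet 4.5 for `GL_n`, from Harish-Chandra's finiteness theorem 4.3 (i).** For an
automorphic representation `π = W / W'` of `GL_n(𝔸_K)` and a level `U`, the `K_∞`-module
`(W / W')^U` has finite `K_∞`-multiplicities. Proof (Borel–Jacquet 4.5–4.6): by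
`AutomorphicRepData.exists_annihilated_stable_gl`, `W = V + W'` with `V` stable and killed by an
ideal `J ≤ Z(𝔤)` of finite codimension; `(W / W')^U` is a `K_∞`-quotient of `S = V ∩ 𝒜^U`
(`exists_surjective_intertwiningMap_kRepFixed_gl`), whose `K_∞`-action is completely reducible
(`isSemisimpleRepresentation_kinf_gl`), so every `K_∞`-map `τ → (W / W')^U` lifts to `S`
(`Representation.IntertwiningMap.exists_comp_eq_of_isSemisimpleRepresentation`), where its values lie
in the finite-dimensional space of forms of level `U`, killed by `J`, of `K_∞`-type `τ`
(`exists_finiteDimensional_forall_intertwiningMap_mem_gl`, Harish-Chandra's finiteness theorem).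
[cite: BorelJacquet1979, 4.5] -/
theorem AutomorphicRepData.isAdmissibleGK_kRepFixed_gl_of_harishChandra_finiteness
    (hHC : harishChandra_finiteness hcpt) (π : AutomorphicRepData (AutomorphyDatum.gl n K hcpt))
    {U : Subgroup (GL (Fin n) (AdeleRing (𝓞 K) K))} (hU : U ∈ finiteLevelsGL n K) :
    IsAdmissibleGK (π.kRepFixed (U.subgroupOf (AutomorphyDatum.gl n K hcpt).finiteAdelic)) := by
  intro T _ _ _ τ _
  refine π.exists_annihilated_stable_gl.elim fun J h ↦ h.elim fun V h ↦ ?_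
  have hJfin := h.1
  have hVW := h.2.1
  have hVst := h.2.2.1
  have hVJ := h.2.2.2.1
  have hWle := h.2.2.2.2
  have hVA : V ≤ automorphicForms (AutomorphyDatum.gl n K hcpt) := hVW.trans π.stable.le_automorphicForms
  refine (π.exists_surjective_intertwiningMap_kRepFixed_gl hU hVW hVst hWle).elim fun hS h ↦
    h.elim fun Φ hΦ ↦ ?_
  have hρ : ∀ (k : (AutomorphyDatum.gl n K hcpt).arch.maximalCompact) (v : ↥(V ⊓ (rightTranslation (AdelicGroupData.gl n K)).fixedPoints U)),
      ((Representation.subrepresentation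
          (MonoidHom.comp (rightTranslation (AdelicGroupData.gl n K)) (AutomorphyDatum.gl n K hcpt).ofK :
            Representation ℂ (AutomorphyDatum.gl n K hcpt).arch.maximalCompact ((AdelicGroupData.gl n K).Adelic → ℂ))
          (V ⊓ (rightTranslation (AdelicGroupData.gl n K)).fixedPoints U) hS k v :
            ↥(V ⊓ (rightTranslation (AdelicGroupData.gl n K)).fixedPoints U)) : (AdelicGroupData.gl n K).Adelic → ℂ) =
        rightTranslation (AdelicGroupData.gl n K) ((AutomorphyDatum.gl n K hcpt).ofK k) v :=
    fun k v ↦ rfl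
  haveI := isSemisimpleRepresentation_kinf_gl (V ⊓ (rightTranslation (AdelicGroupData.gl n K)).fixedPoints U)
    (inf_le_left.trans hVA) _ hρ
  refine (exists_finiteDimensional_forall_intertwiningMap_mem_gl hHC hU hVA J hJfin hVJ _ hρ τ).elim
    fun A h ↦ ?_
  haveI := h.1
  exact Representation.finiteDimensional_intertwiningMap_of_surjective Φ hΦ A h.2

/-- **Automorphic representations of `GL_n(𝔸_K)` are admissible (Borel–Jacquet 1979, 4.5 and 4.6),
granted Harish-Chandra's finiteness theorem (Borel–Jacquet 1979, 4.3 (i); Harish-Chandra, LNM 62,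
Thm. 1).** The named fact `automorphicRep_isAdmissible hcpt` of `LangAutomorphicForms` follows from
the named fact `harishChandra_finiteness hcpt` of the same file: the smoothness of the
`GL_n(𝔸_K^∞)`-action is `AutomorphicRepData.isSmooth_finiteRep_gl` (unconditional), and the
finiteness of the `K_∞`-multiplicities in every `(W / W')^U` is
`AutomorphicRepData.isAdmissibleGK_kRepFixed_gl_of_harishChandra_finiteness`. This is exactly the
dependence in print ("4.5 … follows from 4.3 (i)"; "in view of 4.5, an automorphic representation
is always admissible", 4.6); the discharge of `automorphicRep_isAdmissible` therefore waits only on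
that of `harishChandra_finiteness` (reduction theory). [cite: BorelJacquet1979, 4.5 and 4.6] -/
theorem automorphicRep_isAdmissible_of_harishChandra_finiteness (hHC : harishChandra_finiteness hcpt) :
    automorphicRep_isAdmissible hcpt := fun π ↦
  ⟨π.isSmooth_finiteRep_gl, fun _ hU ↦ π.isAdmissibleGK_kRepFixed_gl_of_harishChandra_finiteness hHC hU⟩

end Assembly

/-! ### 10. Linear algebra: commuting algebraic operators with finite-dimensional joint eigenspaces -/

section GenericEigen

open Polynomial

variable {E : Type*} [AddCommGroup E] [Module ℂ E]

/-- A submodule stable under an endomorphism `a` is stable under every polynomial in `a`. [folklore] -/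
theorem aeval_apply_mem_of_forall_apply_mem (a : Module.End ℂ E) {F : Submodule ℂ E}
    (hF : ∀ x ∈ F, a x ∈ F) (q : ℂ[X]) : ∀ x ∈ F, aeval a q x ∈ F := by
  induction q using Polynomial.induction_on' with
  | add p q hp hq =>
    intro x hx
    rw [map_add, LinearMap.add_apply]
    exact F.add_mem (hp x hx) (hq x hx)
  | monomial k c =>
    intro x hx
    rw [aeval_monomial, Module.End.mul_apply, Module.algebraMap_end_apply]
    refine F.smul_mem c ?_
    induction k generalizing x with
    | zero => simpa using hx
    | succ k ih =>
      rw [pow_succ, Module.End.mul_apply]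
      exact ih (a x) (hF x hx)

/-- **One algebraic operator with finite-dimensional eigenspaces.** Let `a` be an endomorphism of a
complex vector space and `F₀` an `a`-stable subspace on which the eigenspaces of `a` are
finite-dimensional. Then every `a`-stable `F ≤ F₀` killed by a non-zero polynomial `q(a)` is
finite-dimensional: by induction on `deg q`, writing `q = (X - μ) q'`, the subspace
`F' = F ∩ ker q'(a)` is finite-dimensional and `q'(a)` maps `F` into the `μ`-eigenspace with kernel
`F'`. [folklore] -/
theorem finiteDimensional_of_aeval_apply_eq_zero (a : Module.End ℂ E) (F₀ : Submodule ℂ E)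
    (heig : ∀ μ : ℂ, FiniteDimensional ℂ ↥(F₀ ⊓ a.eigenspace μ)) :
    ∀ (d : ℕ) (F : Submodule ℂ E), F ≤ F₀ → (∀ x ∈ F, a x ∈ F) →
      ∀ q : ℂ[X], q ≠ 0 → q.natDegree ≤ d → (∀ x ∈ F, aeval a q x = 0) →
        FiniteDimensional ℂ F := by
  intro d
  induction d with
  | zero =>
    intro F _ _ q hq hdeg hkill
    have hq0 : q = C (q.coeff 0) := eq_C_of_natDegree_eq_zero (Nat.le_zero.1 hdeg)
    have hc : q.coeff 0 ≠ 0 := fun h ↦ hq (by rw [hq0, h, map_zero])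
    have hbot : F = ⊥ := by
      refine (Submodule.eq_bot_iff F).2 fun x hx ↦ ?_
      have h := hkill x hx
      rw [hq0, aeval_C, Module.algebraMap_end_apply] at h
      exact (smul_eq_zero.1 h).resolve_left hc
    rw [hbot]
    infer_instance
  | succ d ih =>
    intro F hFle hFa q hq hdeg hkill
    by_cases hd : q.natDegree ≤ d
    · exact ih F hFle hFa q hq hd hkill
    have hdeg' : q.natDegree = d + 1 := le_antisymm hdeg (Nat.lt_of_not_le hd)
    have hpos : 0 < q.degree := by
      rw [degree_eq_natDegree hq, hdeg']
      exact_mod_cast Nat.succ_pos d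
    obtain ⟨μ, hμ⟩ := Complex.exists_root hpos
    set q' : ℂ[X] := q /ₘ (X - C μ) with hq'_def
    have hfact : (X - C μ) * q' = q := mul_divByMonic_eq_iff_isRoot.2 hμ
    have hq'deg : q'.natDegree ≤ d := by
      rw [hq'_def, natDegree_divByMonic q (monic_X_sub_C μ), natDegree_X_sub_C, hdeg']
      simp
    have hq'ne : q' ≠ 0 := fun h ↦ hq (by rw [← hfact, h, mul_zero])
    -- the map `f = q'(a)` on `F`: kernel `F'`, image in the `μ`-eigenspace
    set f : Module.End ℂ E := aeval a q' with hf_def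
    have hcomm : f * a = a * f := by
      have h : aeval a (q' * X) = aeval a (X * q') := by rw [mul_comm]
      rwa [map_mul, map_mul, aeval_X] at h
    have hfa : ∀ x, f (a x) = a (f x) := fun x ↦ by
      rw [← Module.End.mul_apply, hcomm, Module.End.mul_apply]
    have hfF : ∀ x ∈ F, f x ∈ F := aeval_apply_mem_of_forall_apply_mem a hFa q'
    -- `F' = F ∩ ker f` is finite-dimensional by induction
    have hF'fin : FiniteDimensional ℂ ↥(F ⊓ LinearMap.ker f) := by
      refine ih (F ⊓ LinearMap.ker f) (inf_le_left.trans hFle) (fun x hx ↦ ?_) q' hq'ne hq'deg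
        (fun x hx ↦ hx.2)
      refine Submodule.mem_inf.2 ⟨hFa x hx.1, ?_⟩
      have hx2 : f x = 0 := hx.2
      change f (a x) = 0
      rw [hfa, hx2, map_zero]
    -- `f(F)` lies in the `μ`-eigenspace inside `F₀`
    have hmap : F.map f ≤ F₀ ⊓ a.eigenspace μ := by
      rintro _ ⟨x, hx, rfl⟩
      refine ⟨hFle (hfF x hx), Module.End.mem_eigenspace_iff.2 ?_⟩
      have h := hkill x hx
      rw [← hfact, map_mul, Module.End.mul_apply, map_sub, aeval_X, aeval_C, LinearMap.sub_apply,
        Module.algebraMap_end_apply, sub_eq_zero] at h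
      exact h
    haveI := heig μ
    have h1 : (F.map f).FG :=
      (Submodule.fg_iff_finiteDimensional _).2 (Submodule.finiteDimensional_of_le hmap)
    have h2 : (F ⊓ LinearMap.ker f).FG := (Submodule.fg_iff_finiteDimensional _).2 hF'fin
    exact (Submodule.fg_iff_finiteDimensional _).1 (Submodule.fg_of_fg_map_of_fg_inf_ker f h1 h2)

/-- **Finitely many commuting algebraic operators with finite-dimensional joint eigenspaces.** Let
`a₁, …, aₛ` be pairwise commuting endomorphisms of a complex vector space, `F` a subspace stable
under all of them on which each `aᵢ` is killed by a non-zero polynomial, and suppose every subspace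
of `F` on which all the `aᵢ` act by scalars is finite-dimensional. Then `F` is finite-dimensional
(induction on `s` through `finiteDimensional_of_aeval_apply_eq_zero`: the eigenspaces of `a₁` in
`F` are stable under `a₂, …, aₛ`). [folklore] -/
theorem finiteDimensional_of_forall_joint_eigenspace :
    ∀ (s : ℕ) (a : Fin s → Module.End ℂ E) (F : Submodule ℂ E),
      (∀ i j, Commute (a i) (a j)) → (∀ i, ∀ x ∈ F, a i x ∈ F) →
      (∀ i, ∃ q : ℂ[X], q ≠ 0 ∧ ∀ x ∈ F, aeval (a i) q x = 0) →
      (∀ F' : Submodule ℂ E, F' ≤ F → (∀ i, ∃ μ : ℂ, ∀ x ∈ F', a i x = μ • x) →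
        FiniteDimensional ℂ F') →
      FiniteDimensional ℂ F := by
  intro s
  induction s with
  | zero =>
    intro a F _ _ _ hjoint
    exact hjoint F le_rfl fun i ↦ Fin.elim0 i
  | succ s ih =>
    intro a F hcomm hFa halg hjoint
    obtain ⟨q, hq, hqkill⟩ := halg 0
    refine finiteDimensional_of_aeval_apply_eq_zero (a 0) F (fun μ ↦ ?_) q.natDegree F le_rfl (hFa 0)
      q hq le_rfl hqkill
    -- the `μ`-eigenspace of `a 0` in `F` is stable under the other operators: induction
    refine ih (fun i ↦ a i.succ) (F ⊓ (a 0).eigenspace μ) (fun i j ↦ hcomm _ _) (fun i x hx ↦ ?_)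
      (fun i ↦ ?_) (fun F' hF' hsc ↦ ?_)
    · refine ⟨hFa _ x hx.1, Module.End.mem_eigenspace_iff.2 ?_⟩
      have hx0 := Module.End.mem_eigenspace_iff.1 hx.2
      rw [← Module.End.mul_apply, (hcomm 0 i.succ).eq, Module.End.mul_apply, hx0, map_smul]
    · obtain ⟨q', hq', hk⟩ := halg i.succ
      exact ⟨q', hq', fun x hx ↦ hk x hx.1⟩
    · refine hjoint F' (hF'.trans inf_le_left) fun i ↦ ?_
      refine Fin.cases ⟨μ, fun x hx ↦ Module.End.mem_eigenspace_iff.1 (hF' hx).2⟩ (fun j ↦ hsc j) i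

end GenericEigen

/-! ### 11. Linear algebra: finiteness from the finiteness of character subspaces -/

section GenericCharacter

open Polynomial

variable {E : Type*} [AddCommGroup E] [Module ℂ E] {Z : Type*} [CommRing Z] [Algebra ℝ Z]

/-- An element of a commutative real algebra is killed, modulo an ideal `J` of finite codimension,
by a non-zero real polynomial (the minimal polynomial of its class in `Z ⧸ J`). [folklore] -/
theorem exists_polynomial_ne_zero_aeval_mem (J : Ideal Z) (hJ : FiniteDimensional ℝ (Z ⧸ J))
    (z : Z) : ∃ q : ℝ[X], q ≠ 0 ∧ aeval z q ∈ J := by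
  by_cases hJtop : J = ⊤
  · exact ⟨1, one_ne_zero, hJtop ▸ Submodule.mem_top⟩
  · haveI : Nontrivial (Z ⧸ J) := Ideal.Quotient.nontrivial_iff.2 hJtop
    have hint : Algebra.IsIntegral ℝ (Z ⧸ J) :=
      @Algebra.IsIntegral.of_finite ℝ (Z ⧸ J) _ _ _ (by exact hJ)
    refine ⟨minpoly ℝ (Ideal.Quotient.mkₐ ℝ J z),
      minpoly.ne_zero (hint.isIntegral (Ideal.Quotient.mkₐ ℝ J z)), ?_⟩
    rw [← Ideal.Quotient.eq_zero_iff_mem]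
    have h := minpoly.aeval ℝ (Ideal.Quotient.mkₐ ℝ J z)
    rwa [aeval_algHom_apply, Ideal.Quotient.mkₐ_eq_mk] at h

/-- **Finiteness from the finiteness of character subspaces.** Let a commutative real algebra `Z`
act on a complex vector space through `T`, let `J ≤ Z` be an ideal of finite codimension, and let
`F` be a `Z`-stable subspace killed by `J`. If every subspace of `F` on which `Z` acts through a
character `θ : Z →ₐ[ℝ] ℂ` is finite-dimensional, then `F` is finite-dimensional. (Lift a real
basis of `Z ⧸ J` to `z₁, …, z_d ∈ Z`; the `T zᵢ` are commuting operators on `F`, algebraic because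
`Z ⧸ J` is finite-dimensional, and a joint eigenspace of them is a character subspace since the
`zᵢ` span `Z` modulo `J`; conclude by `finiteDimensional_of_forall_joint_eigenspace`.) This is
the passage from "annihilated by an ideal of finite codimension of `Z(𝔤)`" to "with a given
infinitesimal character" in Harish-Chandra's finiteness theorem (Borel–Jacquet 1979, 4.3 (i);
Harish-Chandra, LNM 62, §2). [folklore] -/
theorem finiteDimensional_of_forall_character (T : Z →ₐ[ℝ] Module.End ℂ E) (J : Ideal Z)
    (hJ : FiniteDimensional ℝ (Z ⧸ J)) (F : Submodule ℂ E) (hFT : ∀ z, ∀ x ∈ F, T z x ∈ F)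
    (hFJ : ∀ z ∈ J, ∀ x ∈ F, T z x = 0)
    (hchar : ∀ F' : Submodule ℂ E, F' ≤ F → ∀ θ : Z →ₐ[ℝ] ℂ,
      (∀ z, ∀ x ∈ F', T z x = θ z • x) → FiniteDimensional ℂ F') :
    FiniteDimensional ℂ F := by
  haveI := hJ
  -- a real basis of `Z ⧸ J`, lifted to `Z`
  set b := Module.finBasis ℝ (Z ⧸ J) with hb_def
  have hzex : ∃ z : Fin (Module.finrank ℝ (Z ⧸ J)) → Z, ∀ i, Ideal.Quotient.mkₐ ℝ J (z i) = b i :=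
    ⟨fun i ↦ (Ideal.Quotient.mkₐ_surjective ℝ J (b i)).choose,
      fun i ↦ (Ideal.Quotient.mkₐ_surjective ℝ J (b i)).choose_spec⟩
  obtain ⟨z, hz⟩ := hzex
  refine finiteDimensional_of_forall_joint_eigenspace _ (fun i ↦ T (z i)) F (fun i j ↦ ?_)
    (fun i x hx ↦ hFT _ x hx) (fun i ↦ ?_) (fun F' hF' hsc ↦ ?_)
  · -- the operators commute
    change T (z i) * T (z j) = T (z j) * T (z i)
    rw [← map_mul, ← map_mul, mul_comm]
  · -- each is algebraic on `F`
    obtain ⟨q, hq, hqJ⟩ := exists_polynomial_ne_zero_aeval_mem J hJ (z i)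
    refine ⟨q.map (algebraMap ℝ ℂ), (Polynomial.map_ne_zero_iff (algebraMap ℝ ℂ).injective).2 hq,
      fun x hx ↦ ?_⟩
    rw [aeval_map_algebraMap, aeval_algHom_apply]
    exact hFJ _ hqJ x hx
  · -- a joint eigenspace of the `T (z i)` inside `F` is a character subspace
    choose μ hμ using hsc
    by_cases hbot : F' = ⊥
    · rw [hbot]
      infer_instance
    obtain ⟨x₀, hx₀F', hx₀⟩ := (Submodule.ne_bot_iff F').1 hbot
    -- the would-be character, as a real linear map
    let θ₀ : Z →ₗ[ℝ] ℂ :=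
      { toFun := fun w ↦ ∑ i, ((b.repr (Ideal.Quotient.mkₐ ℝ J w) i : ℝ) : ℂ) * μ i
        map_add' := fun w w' ↦ by
          simp only [map_add, Finsupp.coe_add, Pi.add_apply, Complex.ofReal_add, add_mul,
            Finset.sum_add_distrib]
        map_smul' := fun r w ↦ by
          simp only [map_smul, Finsupp.coe_smul, Pi.smul_apply, smul_eq_mul, Complex.ofReal_mul,
            RingHom.id_apply, Complex.real_smul, Finset.mul_sum, mul_assoc] }
    have key : ∀ w, ∀ x ∈ F', T w x = θ₀ w • x := by
      intro w x hx
      set r : Fin (Module.finrank ℝ (Z ⧸ J)) → ℝ := fun i ↦ b.repr (Ideal.Quotient.mkₐ ℝ J w) i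
        with hr_def
      have hwJ : w - ∑ i, r i • z i ∈ J := by
        have h0 : Ideal.Quotient.mkₐ ℝ J (w - ∑ i, r i • z i) = 0 := by
          rw [map_sub, map_sum]
          simp_rw [map_smul, hz]
          rw [b.sum_repr (Ideal.Quotient.mkₐ ℝ J w), sub_self]
        rw [Ideal.Quotient.mkₐ_eq_mk] at h0
        exact Ideal.Quotient.eq_zero_iff_mem.1 h0
      have hsplit : w = (w - ∑ i, r i • z i) + ∑ i, r i • z i := (sub_add_cancel _ _).symm
      calc T w x = T (w - ∑ i, r i • z i) x + ∑ i, (r i • T (z i)) x := by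
            conv_lhs => rw [hsplit]
            rw [map_add, LinearMap.add_apply, map_sum, LinearMap.sum_apply]
            simp_rw [map_smul]
        _ = ∑ i, ((r i : ℂ) * μ i) • x := by
            rw [hFJ _ hwJ x (hF' hx), zero_add]
            refine Finset.sum_congr rfl fun i _ ↦ ?_
            rw [LinearMap.smul_apply, hμ i x hx, ← Complex.coe_smul, smul_smul]
        _ = θ₀ w • x := by
            rw [← Finset.sum_smul]
            rfl
    have h1 : θ₀ 1 = 1 := by
      have h := key 1 x₀ hx₀F'
      rw [map_one, Module.End.one_apply] at h
      have h' : (θ₀ 1 - 1) • x₀ = 0 := by rw [sub_smul, one_smul, ← h, sub_self]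
      exact sub_eq_zero.1 ((smul_eq_zero.1 h').resolve_right hx₀)
    have hmul : ∀ w w', θ₀ (w * w') = θ₀ w * θ₀ w' := by
      intro w w'
      have h := key (w * w') x₀ hx₀F'
      rw [map_mul, Module.End.mul_apply, key w' x₀ hx₀F', map_smul, key w x₀ hx₀F', smul_smul]
        at h
      have h' : (θ₀ (w * w') - θ₀ w * θ₀ w') • x₀ = 0 := by rw [sub_smul, ← h, mul_comm, sub_self]
      exact sub_eq_zero.1 ((smul_eq_zero.1 h').resolve_right hx₀)
    exact hchar F' hF' (AlgHom.ofLinearMap θ₀ h1 hmul) fun w x hx ↦ by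
      rw [AlgHom.ofLinearMap_apply]
      exact key w x hx

end GenericCharacter


/-! ### 12. The `τ`-isotypic part of `V^U` is `Z(𝔤)`-stable -/

section Isotypic

variable {n : ℕ} {K : Type} [Field K] [NumberField K] {hcpt : isCompact_glFiniteIntegralLevel n K}

/-- The word action of `U(𝔤)` preserves `S = V ∩ 𝒜^U` for a stable `V` and a level `U`: `V` is
stable under Lie derivatives, and `p (r(u) ψ) = r(u) (p ψ)` for `u ∈ U ≤ G(𝔸_f)`, which commutes
with `G_∞` (`applyFree_comp_mul_right`). Borel–Jacquet 1979, 4.3 (ii) and 4.5. [cite: BorelJacquet1979, 4.3 (ii)] -/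
theorem applyFree_mem_inf_fixedPoints_gl {U : Subgroup (GL (Fin n) (AdeleRing (𝓞 K) K))}
    (hU : U ∈ finiteLevelsGL n K) {V : Submodule ℂ ((AdelicGroupData.gl n K).Adelic → ℂ)}
    (hVst : IsStableSubmodule (AutomorphyDatum.gl n K hcpt) V)
    (p : FreeAlgebra ℝ (AutomorphyDatum.gl n K hcpt).arch.lie) {ψ : (AdelicGroupData.gl n K).Adelic → ℂ}
    (hψ : ψ ∈ V ⊓ (rightTranslation (AdelicGroupData.gl n K)).fixedPoints U) :
    applyFree (AutomorphyDatum.gl n K hcpt).ofArch p ψ ∈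
      V ⊓ (rightTranslation (AdelicGroupData.gl n K)).fixedPoints U := by
  refine Submodule.mem_inf.2 ⟨hVst.applyFree_mem p hψ.1, ?_⟩
  rw [Representation.mem_fixedPoints]
  intro u hu
  have hcomm : ∀ a : (AutomorphyDatum.gl n K hcpt).arch.carrier,
      (AutomorphyDatum.gl n K hcpt).ofArch a * u = u * (AutomorphyDatum.gl n K hcpt).ofArch a :=
    fun a ↦ (AutomorphyDatum.gl n K hcpt).commute_ofArch a u
      ((AutomorphyDatum.gl n K hcpt).le_finiteAdelic U hU hu)
  have key := applyFree_comp_mul_right (AutomorphyDatum.gl n K hcpt).ofArch p ψ hcomm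
  have hfix : (fun g ↦ ψ (g * u)) = ψ :=
    (Representation.mem_fixedPoints _ U ψ).1 (Submodule.mem_inf.1 hψ).2 u hu
  rw [hfix] at key
  exact key.symm

variable {U : Subgroup (GL (Fin n) (AdeleRing (𝓞 K) K))}
  {V : Submodule ℂ ((AdelicGroupData.gl n K).Adelic → ℂ)}
  (ρ : Representation ℂ (AutomorphyDatum.gl n K hcpt).arch.maximalCompact
    ↥(V ⊓ (rightTranslation (AdelicGroupData.gl n K)).fixedPoints U))
  {T : Type} [AddCommGroup T] [Module ℂ T]
  (τ : Representation ℂ (AutomorphyDatum.gl n K hcpt).arch.maximalCompact T)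

/-- **A central word composed with a `K_∞`-map `τ → S = V ∩ 𝒜^U` is again a `K_∞`-map.** For `p`
central and `f' : τ → S` a `K_∞`-map, `t ↦ p (f' t)` is a `K_∞`-map `τ → S`: it is complex linear on
the smooth functions of `S` (`applyFree_add_right_of_top`), takes values in `S`
(`applyFree_mem_inf_fixedPoints_gl`), and commutes with `r(k)` for EVERY `k ∈ K_∞`, all components
(`applyFree_archTranslate_of_isCentralWord`: central elements of `U(𝔤)` are invariant under
`Ad(GL_n(K_∞))`). Borel–Jacquet 1979, 4.3 (ii) ("`Z(𝔤)` commutes with `K_∞`"). [cite: BorelJacquet1979, 4.3 (ii)] -/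
theorem exists_intertwiningMap_coe_eq_applyFree_gl (hU : U ∈ finiteLevelsGL n K)
    (hVst : IsStableSubmodule (AutomorphyDatum.gl n K hcpt) V)
    (hρ : ∀ (k : (AutomorphyDatum.gl n K hcpt).arch.maximalCompact)
      (v : ↥(V ⊓ (rightTranslation (AdelicGroupData.gl n K)).fixedPoints U)),
      ((ρ k v : ↥(V ⊓ (rightTranslation (AdelicGroupData.gl n K)).fixedPoints U)) :
          (AdelicGroupData.gl n K).Adelic → ℂ) =
        rightTranslation (AdelicGroupData.gl n K) ((AutomorphyDatum.gl n K hcpt).ofK k) v)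
    {p : FreeAlgebra ℝ (AutomorphyDatum.gl n K hcpt).arch.lie} (hp : IsCentralWord p)
    (f' : τ.IntertwiningMap ρ) :
    ∃ f'' : τ.IntertwiningMap ρ, ∀ t,
      ((f'' t : ↥(V ⊓ (rightTranslation (AdelicGroupData.gl n K)).fixedPoints U)) :
          (AdelicGroupData.gl n K).Adelic → ℂ) =
        applyFree (AutomorphyDatum.gl n K hcpt).ofArch p (f' t) := by
  have hH : (AutomorphyDatum.gl n K hcpt).arch.lie = ⊤ := archGroupGL_lie n K
  have hc : (AutomorphyDatum.gl n K hcpt).arch.carrier = ⊤ := archGroupGL_carrier n K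
  have hsm : ∀ s : ↥(V ⊓ (rightTranslation (AdelicGroupData.gl n K)).fixedPoints U),
      IsArchSmooth (AutomorphyDatum.gl n K hcpt).ofArch (s : (AdelicGroupData.gl n K).Adelic → ℂ) :=
    fun s ↦ hVst.isArchSmooth (Submodule.mem_inf.1 s.2).1
  let L : T →ₗ[ℂ] ↥(V ⊓ (rightTranslation (AdelicGroupData.gl n K)).fixedPoints U) :=
    { toFun := fun t ↦ ⟨applyFree (AutomorphyDatum.gl n K hcpt).ofArch p (f' t),
        applyFree_mem_inf_fixedPoints_gl hU hVst p (f' t).2⟩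
      map_add' := fun t t' ↦ Subtype.ext (by
        change applyFree _ p ((f' (t + t') : ↥(V ⊓ (rightTranslation (AdelicGroupData.gl n K)).fixedPoints U)) :
            (AdelicGroupData.gl n K).Adelic → ℂ) =
          applyFree _ p (f' t) + applyFree _ p (f' t')
        rw [map_add, Submodule.coe_add, applyFree_add_right_of_top _ hH hc p (hsm _) (hsm _)])
      map_smul' := fun c t ↦ Subtype.ext (by
        change applyFree _ p ((f' (c • t) : ↥(V ⊓ (rightTranslation (AdelicGroupData.gl n K)).fixedPoints U)) :
            (AdelicGroupData.gl n K).Adelic → ℂ) =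
          c • applyFree _ p (f' t)
        rw [map_smul, Submodule.coe_smul, applyFree_smul_right]) }
  refine ⟨⟨L, fun k ↦ LinearMap.ext fun t ↦ Subtype.ext ?_⟩, fun t ↦ rfl⟩
  change applyFree _ p ((f' (τ k t) : ↥(V ⊓ (rightTranslation (AdelicGroupData.gl n K)).fixedPoints U)) :
      (AdelicGroupData.gl n K).Adelic → ℂ) =
    ((ρ k (L t) : ↥(V ⊓ (rightTranslation (AdelicGroupData.gl n K)).fixedPoints U)) :
      (AdelicGroupData.gl n K).Adelic → ℂ)
  rw [Representation.IntertwiningMap.isIntertwining τ ρ f' k t, hρ k (f' t), hρ k (L t),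
    ← AutomorphyDatum.archTranslate_ofK,
    applyFree_archTranslate_of_isCentralWord _ hH hc _ hp (hsm _)]
  rfl

/-- **The `τ`-isotypic part `S_τ = ∑_{f'} im f'` of `S = V ∩ 𝒜^U` (sum over all `K_∞`-maps
`f' : τ → S`) is stable under `Z(𝔤)`**: for a central word `p` and `s ∈ S_τ`, `p s ∈ S_τ`
(on a generator `f' t` it is the value at `t` of the `K_∞`-map `p ∘ f'`,
`exists_intertwiningMap_coe_eq_applyFree_gl`; `p` is additive on smooth functions).
Borel–Jacquet 1979, 4.3 (ii) and 4.5. [cite: BorelJacquet1979, 4.5] -/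
theorem exists_mem_iSup_range_coe_eq_applyFree_gl (hU : U ∈ finiteLevelsGL n K)
    (hVst : IsStableSubmodule (AutomorphyDatum.gl n K hcpt) V)
    (hρ : ∀ (k : (AutomorphyDatum.gl n K hcpt).arch.maximalCompact)
      (v : ↥(V ⊓ (rightTranslation (AdelicGroupData.gl n K)).fixedPoints U)),
      ((ρ k v : ↥(V ⊓ (rightTranslation (AdelicGroupData.gl n K)).fixedPoints U)) :
          (AdelicGroupData.gl n K).Adelic → ℂ) =
        rightTranslation (AdelicGroupData.gl n K) ((AutomorphyDatum.gl n K hcpt).ofK k) v)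
    {p : FreeAlgebra ℝ (AutomorphyDatum.gl n K hcpt).arch.lie} (hp : IsCentralWord p)
    {s : ↥(V ⊓ (rightTranslation (AdelicGroupData.gl n K)).fixedPoints U)}
    (hs : s ∈ ⨆ f' : τ.IntertwiningMap ρ, LinearMap.range f'.toLinearMap) :
    ∃ s' : ↥(V ⊓ (rightTranslation (AdelicGroupData.gl n K)).fixedPoints U),
      s' ∈ (⨆ f' : τ.IntertwiningMap ρ, LinearMap.range f'.toLinearMap) ∧
      (s' : (AdelicGroupData.gl n K).Adelic → ℂ) = applyFree (AutomorphyDatum.gl n K hcpt).ofArch p s := by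
  have hH : (AutomorphyDatum.gl n K hcpt).arch.lie = ⊤ := archGroupGL_lie n K
  have hc : (AutomorphyDatum.gl n K hcpt).arch.carrier = ⊤ := archGroupGL_carrier n K
  have hsm : ∀ s : ↥(V ⊓ (rightTranslation (AdelicGroupData.gl n K)).fixedPoints U),
      IsArchSmooth (AutomorphyDatum.gl n K hcpt).ofArch (s : (AdelicGroupData.gl n K).Adelic → ℂ) :=
    fun s ↦ hVst.isArchSmooth (Submodule.mem_inf.1 s.2).1
  refine Submodule.iSup_induction (fun f' : τ.IntertwiningMap ρ ↦ LinearMap.range f'.toLinearMap)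
    (motive := fun s ↦ ∃ s' : ↥(V ⊓ (rightTranslation (AdelicGroupData.gl n K)).fixedPoints U),
      s' ∈ (⨆ f' : τ.IntertwiningMap ρ, LinearMap.range f'.toLinearMap) ∧
      (s' : (AdelicGroupData.gl n K).Adelic → ℂ) = applyFree (AutomorphyDatum.gl n K hcpt).ofArch p s)
    hs (fun f' s hs' ↦ ?_) ⟨0, Submodule.zero_mem _, ?_⟩ (fun s₁ s₂ h₁ h₂ ↦ ?_)
  · refine (LinearMap.mem_range.1 hs').elim fun t ht ↦ ?_
    refine (exists_intertwiningMap_coe_eq_applyFree_gl ρ τ hU hVst hρ hp f').elim fun f'' hf'' ↦ ?_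
    refine ⟨f'' t, Submodule.mem_iSup_of_mem f'' (LinearMap.mem_range_self _ t), ?_⟩
    rw [hf'' t, ← ht]
    rfl
  · rw [ZeroMemClass.coe_zero, applyFree_zero_right]
  · refine h₁.elim fun s₁' h₁' ↦ h₂.elim fun s₂' h₂' ↦ ⟨s₁' + s₂', Submodule.add_mem _ h₁'.1 h₂'.1, ?_⟩
    rw [Submodule.coe_add, Submodule.coe_add, applyFree_add_right_of_top _ hH hc p (hsm _) (hsm _),
      h₁'.2, h₂'.2]

/-- The `K_∞`-slices `k ↦ s (g k)` of an element `s` of the `τ`-isotypic part `S_τ` are matrix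
coefficients of `τ` (for a generator `f' t`: `(f' t)(g k) = (f' (τ(k) t))(g)`). Borel–Jacquet 1979,
4.3 (i) and 4.5. [cite: BorelJacquet1979, 4.5] -/
theorem slice_mem_coeffSpace_of_mem_iSup_range_gl
    (hρ : ∀ (k : (AutomorphyDatum.gl n K hcpt).arch.maximalCompact)
      (v : ↥(V ⊓ (rightTranslation (AdelicGroupData.gl n K)).fixedPoints U)),
      ((ρ k v : ↥(V ⊓ (rightTranslation (AdelicGroupData.gl n K)).fixedPoints U)) :
          (AdelicGroupData.gl n K).Adelic → ℂ) =
        rightTranslation (AdelicGroupData.gl n K) ((AutomorphyDatum.gl n K hcpt).ofK k) v)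
    {s : ↥(V ⊓ (rightTranslation (AdelicGroupData.gl n K)).fixedPoints U)}
    (hs : s ∈ ⨆ f' : τ.IntertwiningMap ρ, LinearMap.range f'.toLinearMap)
    (g : (AdelicGroupData.gl n K).Adelic) :
    (fun k : (AutomorphyDatum.gl n K hcpt).arch.maximalCompact ↦
        (s : (AdelicGroupData.gl n K).Adelic → ℂ) (g * (AutomorphyDatum.gl n K hcpt).ofK k)) ∈
      coeffSpace (fun k ↦ (τ k : T →ₗ[ℂ] T)) := by
  revert g
  refine Submodule.iSup_induction (fun f' : τ.IntertwiningMap ρ ↦ LinearMap.range f'.toLinearMap)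
    (motive := fun s : ↥(V ⊓ (rightTranslation (AdelicGroupData.gl n K)).fixedPoints U) ↦
      ∀ g : (AdelicGroupData.gl n K).Adelic,
        (fun k : (AutomorphyDatum.gl n K hcpt).arch.maximalCompact ↦
          (s : (AdelicGroupData.gl n K).Adelic → ℂ) (g * (AutomorphyDatum.gl n K hcpt).ofK k)) ∈
        coeffSpace (fun k ↦ (τ k : T →ₗ[ℂ] T)))
    hs (fun f' s hs' g ↦ ?_) (fun g ↦ (coeffSpace _).zero_mem) (fun s₁ s₂ h₁ h₂ g ↦ (coeffSpace _).add_mem (h₁ g) (h₂ g))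
  refine (LinearMap.mem_range.1 hs').elim fun t ht ↦ ?_
  have hslice : (fun k : (AutomorphyDatum.gl n K hcpt).arch.maximalCompact ↦
      (s : (AdelicGroupData.gl n K).Adelic → ℂ) (g * (AutomorphyDatum.gl n K hcpt).ofK k)) =
      fun k ↦ ((LinearMap.proj g : ((AdelicGroupData.gl n K).Adelic → ℂ) →ₗ[ℂ] ℂ) ∘ₗ
        (V ⊓ (rightTranslation (AdelicGroupData.gl n K)).fixedPoints U).subtype ∘ₗ f'.toLinearMap) (τ k t) := by
    funext k
    change _ = ((f' (τ k t) : ↥(V ⊓ (rightTranslation (AdelicGroupData.gl n K)).fixedPoints U)) :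
      (AdelicGroupData.gl n K).Adelic → ℂ) g
    rw [Representation.IntertwiningMap.isIntertwining τ ρ f' k t, hρ, ← ht]
    rfl
  rw [hslice]
  exact coeff_mem_coeffSpace _ _ t

end Isotypic

/-! ### 13. Finiteness of the `τ`-isotypic part from the character form of Harish-Chandra's theorem -/

section CharacterForm

variable {n : ℕ} {K : Type} [Field K] [NumberField K] {hcpt : isCompact_glFiniteIntegralLevel n K}

/-- Harish-Chandra's finiteness theorem in the character form (the named fact
`harishChandra_finiteness_gl hcpt` of `AutomorphicRepsGL`, Borel–Jacquet 1979, 4.3 (i)) spelled with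
the archimedean objects of the datum `AutomorphyDatum.gl n K hcpt` and with the finiteness instance as
an explicit hypothesis. [cite: BorelJacquet1979, 4.3 (i)] -/
theorem harishChandra_finiteness_gl.apply_gl (hHC : harishChandra_finiteness_gl hcpt)
    {U : Subgroup (GL (Fin n) (AdeleRing (𝓞 K) K))} (hU : U ∈ finiteLevelsGL n K)
    (θ : centerU (AutomorphyDatum.gl n K hcpt).arch →ₐ[ℝ] ℂ)
    (M : Submodule ℂ ((AutomorphyDatum.gl n K hcpt).arch.maximalCompact → ℂ)) (hMfin : FiniteDimensional ℂ M)
    (hM : ∀ k₀ : (AutomorphyDatum.gl n K hcpt).arch.maximalCompact, ∀ f ∈ M, (fun k ↦ f (k * k₀)) ∈ M) :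
    FiniteDimensional ℂ (Submodule.span ℂ
      {φ : (AdelicGroupData.gl n K).Adelic → ℂ | IsAutomorphicForm (AutomorphyDatum.gl n K hcpt) φ ∧
        IsRightInvariantUnder U φ ∧ HasZCharacter (AutomorphyDatum.gl n K hcpt).ofArch φ θ ∧
          ∀ g : (AdelicGroupData.gl n K).Adelic,
            (fun k : (AutomorphyDatum.gl n K hcpt).arch.maximalCompact ↦
              φ (g * (AutomorphyDatum.gl n K hcpt).ofK k)) ∈ M}) :=
  @hHC U hU θ M hMfin hM

variable {U : Subgroup (GL (Fin n) (AdeleRing (𝓞 K) K))}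
  {V : Submodule ℂ ((AdelicGroupData.gl n K).Adelic → ℂ)}

/-- **A character subspace of the `τ`-isotypic part is finite-dimensional** (the input to
`finiteDimensional_of_forall_character`): a space `F'` of smooth functions each of which is (the
underlying function of) an element of `S_τ = ∑_{f'} im f'` and has `Z(𝔤)`-character `θ` consists of
automorphic forms of level `U`, character `θ`, with `K_∞`-slices among the matrix coefficients of `τ`
(`slice_mem_coeffSpace_of_mem_iSup_range_gl`), so it embeds in the span bounded by
`harishChandra_finiteness_gl hcpt`. Borel–Jacquet 1979, 4.3 (i) and 4.5. [cite: BorelJacquet1979, 4.3 (i) and 4.5] -/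
theorem finiteDimensional_of_forall_hasZCharacter_gl (hHC : harishChandra_finiteness_gl hcpt)
    (hU : U ∈ finiteLevelsGL n K) (hVst : IsStableSubmodule (AutomorphyDatum.gl n K hcpt) V)
    (ρ : Representation ℂ (AutomorphyDatum.gl n K hcpt).arch.maximalCompact
      ↥(V ⊓ (rightTranslation (AdelicGroupData.gl n K)).fixedPoints U))
    (hρ : ∀ (k : (AutomorphyDatum.gl n K hcpt).arch.maximalCompact)
      (v : ↥(V ⊓ (rightTranslation (AdelicGroupData.gl n K)).fixedPoints U)),
      ((ρ k v : ↥(V ⊓ (rightTranslation (AdelicGroupData.gl n K)).fixedPoints U)) :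
          (AdelicGroupData.gl n K).Adelic → ℂ) =
        rightTranslation (AdelicGroupData.gl n K) ((AutomorphyDatum.gl n K hcpt).ofK k) v)
    {T : Type} [AddCommGroup T] [Module ℂ T] [FiniteDimensional ℂ T]
    (τ : Representation ℂ (AutomorphyDatum.gl n K hcpt).arch.maximalCompact T)
    (θ : centerU (AutomorphyDatum.gl n K hcpt).arch →ₐ[ℝ] ℂ)
    (F' : Submodule ℂ ↥(archSmooth (AutomorphyDatum.gl n K hcpt).ofArch))
    (hF'A : ∀ x ∈ F', ∃ s : ↥(V ⊓ (rightTranslation (AdelicGroupData.gl n K)).fixedPoints U),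
      s ∈ (⨆ f' : τ.IntertwiningMap ρ, LinearMap.range f'.toLinearMap) ∧
      (s : (AdelicGroupData.gl n K).Adelic → ℂ) = x)
    (hF'θ : ∀ x ∈ F', HasZCharacter (AutomorphyDatum.gl n K hcpt).ofArch
      ((x : ↥(archSmooth (AutomorphyDatum.gl n K hcpt).ofArch)) : (AdelicGroupData.gl n K).Adelic → ℂ) θ) :
    FiniteDimensional ℂ F' := by
  -- the matrix coefficients of `τ`, a finite-dimensional right-stable space of functions on `K_∞`
  have hM : ∀ k₀ : (AutomorphyDatum.gl n K hcpt).arch.maximalCompact,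
      ∀ f ∈ coeffSpace (fun k ↦ (τ k : T →ₗ[ℂ] T)), (fun k ↦ f (k * k₀)) ∈ coeffSpace (fun k ↦ (τ k : T →ₗ[ℂ] T)) :=
    fun k₀ f hf ↦ comp_mul_right_mem_coeffSpace (fun k k' ↦ τ.map_mul k k') k₀ hf
  have hfin := harishChandra_finiteness_gl.apply_gl hHC hU θ
    (coeffSpace (fun k ↦ (τ k : T →ₗ[ℂ] T))) (finiteDimensional_coeffSpace _) hM
  -- name the span bounded by `hHC` (kept opaque, with its defining equation)
  have hHex : ∃ H : Submodule ℂ ((AdelicGroupData.gl n K).Adelic → ℂ), H = Submodule.span ℂ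
      {φ : (AdelicGroupData.gl n K).Adelic → ℂ | IsAutomorphicForm (AutomorphyDatum.gl n K hcpt) φ ∧
        IsRightInvariantUnder U φ ∧ HasZCharacter (AutomorphyDatum.gl n K hcpt).ofArch φ θ ∧
          ∀ g : (AdelicGroupData.gl n K).Adelic,
            (fun k : (AutomorphyDatum.gl n K hcpt).arch.maximalCompact ↦
              φ (g * (AutomorphyDatum.gl n K hcpt).ofK k)) ∈ coeffSpace (fun k ↦ (τ k : T →ₗ[ℂ] T))} :=
    ⟨_, rfl⟩
  refine hHex.elim fun H hHdef ↦ ?_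
  have hHfin : FiniteDimensional ℂ H := by
    rw [hHdef]
    exact hfin
  -- every element of `F'` lies in `H`
  have hmemH : ∀ x : ↥F', (((x : ↥F') : ↥(archSmooth (AutomorphyDatum.gl n K hcpt).ofArch)) :
      (AdelicGroupData.gl n K).Adelic → ℂ) ∈ H := by
    intro x
    refine (hF'A _ x.2).elim fun s h ↦ ?_
    rw [hHdef, ← h.2]
    refine Submodule.subset_span ⟨isAutomorphicForm_of_mem_automorphicForms_gl
      (hVst.le_automorphicForms (Submodule.mem_inf.1 s.2).1),
      fun u hu g ↦ congrFun ((Representation.mem_fixedPoints _ U _).1 (Submodule.mem_inf.1 s.2).2 u hu) g,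
      ?_, fun g ↦ slice_mem_coeffSpace_of_mem_iSup_range_gl ρ τ hρ h.1 g⟩
    rw [h.2]
    exact hF'θ _ x.2
  let L : ↥F' →ₗ[ℂ] ↥H :=
    { toFun := fun x ↦ ⟨_, hmemH x⟩
      map_add' := fun x y ↦ Subtype.ext rfl
      map_smul' := fun c x ↦ Subtype.ext rfl }
  refine @FiniteDimensional.of_injective ℂ _ _ _ _ _ _ _ L (fun x y hxy ↦ ?_) hHfin
  exact Subtype.ext (Subtype.ext (congrArg (fun w : ↥H ↦ (w : (AdelicGroupData.gl n K).Adelic → ℂ)) hxy))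

/-- **All `K_∞`-maps `τ → S = V ∩ 𝒜^U` take values in one finite-dimensional space, from the
CHARACTER form of Harish-Chandra's finiteness theorem** (`harishChandra_finiteness_gl hcpt`: forms of a
level, a `Z(𝔤)`-character and finitely many `K_∞`-types span a finite-dimensional space), for `V`
stable and killed by an ideal `J ≤ Z(𝔤)` of finite codimension. The space is the `τ`-isotypic part
`S_τ = ∑_{f'} im f'`. It is `Z(𝔤)`-stable (`exists_mem_iSup_range_coe_eq_applyFree_gl`) and killed
by `J`, so `Z(𝔤)` acts on it through the finite-dimensional commutative algebra `Z(𝔤) ⧸ J`; by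
`finiteDimensional_of_forall_character` it suffices that its subspaces on which `Z(𝔤)` acts by a
character `θ` be finite-dimensional — and those consist of automorphic forms of level `U`,
`Z(𝔤)`-character `θ` and `K_∞`-slices among the matrix coefficients of `τ`
(`slice_mem_coeffSpace_of_mem_iSup_range_gl`), to which `harishChandra_finiteness_gl` applies. This is
the reduction of "annihilated by an ideal of finite codimension" to "with a given infinitesimal
character" in Borel–Jacquet 1979, 4.3 (i) (there left to the reader: "we may replace `J` by the
kernel of a character"), carried out inside `W`. [cite: BorelJacquet1979, 4.3 (i) and 4.5] -/
theorem exists_finiteDimensional_forall_intertwiningMap_mem_gl_of_character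
    (hHC : harishChandra_finiteness_gl hcpt) (hU : U ∈ finiteLevelsGL n K)
    (hVst : IsStableSubmodule (AutomorphyDatum.gl n K hcpt) V)
    (J : Ideal (centerU (AutomorphyDatum.gl n K hcpt).arch))
    (hJfin : FiniteDimensional ℝ (centerU (AutomorphyDatum.gl n K hcpt).arch ⧸ J))
    (hVJ : ∀ ψ ∈ V, ∀ (p : FreeAlgebra ℝ (AutomorphyDatum.gl n K hcpt).arch.lie) (hp : IsCentralWord p),
      (⟨freeToEnveloping (AutomorphyDatum.gl n K hcpt).arch p, hp⟩ : centerU (AutomorphyDatum.gl n K hcpt).arch) ∈ J →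
        applyFree (AutomorphyDatum.gl n K hcpt).ofArch p ψ = 0)
    (ρ : Representation ℂ (AutomorphyDatum.gl n K hcpt).arch.maximalCompact
      ↥(V ⊓ (rightTranslation (AdelicGroupData.gl n K)).fixedPoints U))
    (hρ : ∀ (k : (AutomorphyDatum.gl n K hcpt).arch.maximalCompact)
      (v : ↥(V ⊓ (rightTranslation (AdelicGroupData.gl n K)).fixedPoints U)),
      ((ρ k v : ↥(V ⊓ (rightTranslation (AdelicGroupData.gl n K)).fixedPoints U)) :
          (AdelicGroupData.gl n K).Adelic → ℂ) =
        rightTranslation (AdelicGroupData.gl n K) ((AutomorphyDatum.gl n K hcpt).ofK k) v)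
    {T : Type} [AddCommGroup T] [Module ℂ T] [FiniteDimensional ℂ T]
    (τ : Representation ℂ (AutomorphyDatum.gl n K hcpt).arch.maximalCompact T) :
    ∃ A : Submodule ℂ ↥(V ⊓ (rightTranslation (AdelicGroupData.gl n K)).fixedPoints U),
      FiniteDimensional ℂ A ∧ ∀ f' : τ.IntertwiningMap ρ, ∀ t, f' t ∈ A := by
  have hH : (AutomorphyDatum.gl n K hcpt).arch.lie = ⊤ := archGroupGL_lie n K
  have hc : (AutomorphyDatum.gl n K hcpt).arch.carrier = ⊤ := archGroupGL_carrier n K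
  have hsm : ∀ s : ↥(V ⊓ (rightTranslation (AdelicGroupData.gl n K)).fixedPoints U),
      IsArchSmooth (AutomorphyDatum.gl n K hcpt).ofArch (s : (AdelicGroupData.gl n K).Adelic → ℂ) :=
    fun s ↦ hVst.isArchSmooth (Submodule.mem_inf.1 s.2).1
  -- the `τ`-isotypic part `A = S_τ` (kept opaque, with its defining equation)
  have hAex : ∃ A : Submodule ℂ ↥(V ⊓ (rightTranslation (AdelicGroupData.gl n K)).fixedPoints U),
      A = ⨆ f' : τ.IntertwiningMap ρ, LinearMap.range f'.toLinearMap := ⟨_, rfl⟩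
  refine hAex.elim fun A hA ↦ ⟨A, ?_, fun f' t ↦ hA ▸ Submodule.mem_iSup_of_mem f' (LinearMap.mem_range_self _ t)⟩
  -- its image `Amap` in the function space (kept opaque: membership, smoothness, transport of finiteness)
  have hAmapex : ∃ Amap : Submodule ℂ ((AdelicGroupData.gl n K).Adelic → ℂ),
      (∀ φ, φ ∈ Amap ↔ ∃ s : ↥(V ⊓ (rightTranslation (AdelicGroupData.gl n K)).fixedPoints U), s ∈ A ∧
        (s : (AdelicGroupData.gl n K).Adelic → ℂ) = φ) ∧
      (FiniteDimensional ℂ Amap → FiniteDimensional ℂ A) :=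
    ⟨A.map (V ⊓ (rightTranslation (AdelicGroupData.gl n K)).fixedPoints U).subtype,
      fun φ ↦ Submodule.mem_map, fun h ↦
        @Module.Finite.equiv _ _ _ _ _ _ _ _ h (Submodule.equivMapOfInjective _
          (V ⊓ (rightTranslation (AdelicGroupData.gl n K)).fixedPoints U).injective_subtype A).symm⟩
  refine hAmapex.elim fun Amap hAmap' ↦ ?_
  have hAmap_mem := hAmap'.1
  have hAle : Amap ≤ archSmooth (AutomorphyDatum.gl n K hcpt).ofArch := by
    intro φ hφ
    refine ((hAmap_mem φ).1 hφ).elim fun s h ↦ ?_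
    rw [← h.2]
    exact (mem_archSmooth_iff _ _).2 (hsm s)
  -- `Z(𝔤)` acting on the smooth functions (kept opaque: an algebra map acting by the word action)
  have hTZex : ∃ TZ : centerU (AutomorphyDatum.gl n K hcpt).arch →ₐ[ℝ]
      Module.End ℂ ↥(archSmooth (AutomorphyDatum.gl n K hcpt).ofArch),
      ∀ (p : FreeAlgebra ℝ (AutomorphyDatum.gl n K hcpt).arch.lie) (hp : IsCentralWord p)
        (x : ↥(archSmooth (AutomorphyDatum.gl n K hcpt).ofArch)),
        ((TZ ⟨freeToEnveloping _ p, hp⟩ x : ↥(archSmooth (AutomorphyDatum.gl n K hcpt).ofArch)) :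
          (AdelicGroupData.gl n K).Adelic → ℂ) = applyFree (AutomorphyDatum.gl n K hcpt).ofArch p x := by
    refine ⟨(envelopingAction (lieDerivRep (AutomorphyDatum.gl n K hcpt).ofArch hH hc)).comp
        (centerU (AutomorphyDatum.gl n K hcpt).arch).val, fun p hp x ↦ ?_⟩
    rw [AlgHom.comp_apply, Subalgebra.coe_val]
    exact coe_envelopingAction_freeToEnveloping hH hc p x
  refine hTZex.elim fun TZ hTZ_apply ↦ ?_
  -- the subspace `F` of smooth functions corresponding to `Amap` (kept opaque likewise)
  have hFex : ∃ F : Submodule ℂ ↥(archSmooth (AutomorphyDatum.gl n K hcpt).ofArch),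
      (∀ x, x ∈ F ↔ (x : (AdelicGroupData.gl n K).Adelic → ℂ) ∈ Amap) ∧
      (FiniteDimensional ℂ F → FiniteDimensional ℂ Amap) :=
    ⟨Amap.comap (archSmooth (AutomorphyDatum.gl n K hcpt).ofArch).subtype, fun x ↦ Submodule.mem_comap,
      fun h ↦ @Module.Finite.equiv _ _ _ _ _ _ _ _ h (Submodule.comapSubtypeEquivOfLe hAle)⟩
  refine hFex.elim fun F hF' ↦ ?_
  have hF_mem := hF'.1
  -- `F` is finite-dimensional, by `finiteDimensional_of_forall_character`
  have hFfin : FiniteDimensional ℂ F := by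
    refine finiteDimensional_of_forall_character TZ J hJfin F (fun z x hx ↦ ?_) (fun z hz x hx ↦ ?_)
      (fun F' hF' θ hθ ↦ ?_)
    · -- `Z(𝔤)`-stability
      rw [hF_mem] at hx ⊢
      refine (exists_isCentralWord_freeToEnveloping_eq _ z).elim fun p h ↦ h.elim fun hp hpz ↦ ?_
      rw [← hpz, hTZ_apply p hp x]
      refine ((hAmap_mem _).1 hx).elim fun s h ↦ ?_
      refine (exists_mem_iSup_range_coe_eq_applyFree_gl ρ τ hU hVst hρ hp (s := s) (hA ▸ h.1)).elim
        fun s' h' ↦ (hAmap_mem _).2 ⟨s', hA ▸ h'.1, ?_⟩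
      rw [h'.2, h.2]
    · -- killed by `J`
      rw [hF_mem] at hx
      refine (exists_isCentralWord_freeToEnveloping_eq _ z).elim fun p h ↦ h.elim fun hp hpz ↦ ?_
      refine Subtype.ext ?_
      rw [← hpz, hTZ_apply p hp x, ZeroMemClass.coe_zero]
      refine ((hAmap_mem _).1 hx).elim fun s h ↦ ?_
      rw [← h.2]
      exact hVJ _ (Submodule.mem_inf.1 s.2).1 p hp (hpz ▸ hz)
    · -- a character subspace consists of forms of level `U`, character `θ`, `K_∞`-type `τ`
      refine finiteDimensional_of_forall_hasZCharacter_gl hHC hU hVst ρ hρ τ θ F' (fun x hx ↦ ?_)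
        (fun x hx p hp ↦ ?_)
      · have hxF : x ∈ F := hF' hx
        rw [hF_mem] at hxF
        refine ((hAmap_mem _).1 hxF).elim fun s h ↦ ⟨s, hA ▸ h.1, h.2⟩
      · exact (hTZ_apply p hp x).symm.trans
          (congrArg Subtype.val (hθ ⟨freeToEnveloping (AutomorphyDatum.gl n K hcpt).arch p, hp⟩ x hx))
  -- transport the finiteness back to `A`
  exact hAmap'.2 (hF'.2 hFfin)

end CharacterForm

/-! ### 14. Assembly from the character form: automorphic representations of `GL_n(𝔸_K)` are
admissible, granted `harishChandra_finiteness_gl` -/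

section AssemblyCharacter

variable {n : ℕ} {K : Type} [Field K] [NumberField K] {hcpt : isCompact_glFiniteIntegralLevel n K}

/-- **Borel–Jacquet 4.5 for `GL_n`, from the character form of Harish-Chandra's finiteness theorem**
(`harishChandra_finiteness_gl hcpt`): for an automorphic representation `π = W / W'` of `GL_n(𝔸_K)` and
a level `U`, the `K_∞`-module `(W / W')^U` has finite `K_∞`-multiplicities. Same proof as
`AutomorphicRepData.isAdmissibleGK_kRepFixed_gl_of_harishChandra_finiteness`, with the finiteness of
the `τ`-isotypic part of `V ∩ 𝒜^U` now supplied by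
`exists_finiteDimensional_forall_intertwiningMap_mem_gl_of_character`. [cite: BorelJacquet1979, 4.5] -/
theorem AutomorphicRepData.isAdmissibleGK_kRepFixed_gl_of_harishChandra_finiteness_gl
    (hHC : harishChandra_finiteness_gl hcpt) (π : AutomorphicRepData (AutomorphyDatum.gl n K hcpt))
    {U : Subgroup (GL (Fin n) (AdeleRing (𝓞 K) K))} (hU : U ∈ finiteLevelsGL n K) :
    IsAdmissibleGK (π.kRepFixed (U.subgroupOf (AutomorphyDatum.gl n K hcpt).finiteAdelic)) := by
  intro T _ _ _ τ _
  refine π.exists_annihilated_stable_gl.elim fun J h ↦ h.elim fun V h ↦ ?_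
  have hJfin := h.1
  have hVW := h.2.1
  have hVst := h.2.2.1
  have hVJ := h.2.2.2.1
  have hWle := h.2.2.2.2
  have hVA : V ≤ automorphicForms (AutomorphyDatum.gl n K hcpt) := hVW.trans π.stable.le_automorphicForms
  refine (π.exists_surjective_intertwiningMap_kRepFixed_gl hU hVW hVst hWle).elim fun hS h ↦
    h.elim fun Φ hΦ ↦ ?_
  have hρ : ∀ (k : (AutomorphyDatum.gl n K hcpt).arch.maximalCompact) (v : ↥(V ⊓ (rightTranslation (AdelicGroupData.gl n K)).fixedPoints U)),
      ((Representation.subrepresentation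
          (MonoidHom.comp (rightTranslation (AdelicGroupData.gl n K)) (AutomorphyDatum.gl n K hcpt).ofK :
            Representation ℂ (AutomorphyDatum.gl n K hcpt).arch.maximalCompact ((AdelicGroupData.gl n K).Adelic → ℂ))
          (V ⊓ (rightTranslation (AdelicGroupData.gl n K)).fixedPoints U) hS k v :
            ↥(V ⊓ (rightTranslation (AdelicGroupData.gl n K)).fixedPoints U)) : (AdelicGroupData.gl n K).Adelic → ℂ) =
        rightTranslation (AdelicGroupData.gl n K) ((AutomorphyDatum.gl n K hcpt).ofK k) v :=
    fun k v ↦ rfl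
  haveI := isSemisimpleRepresentation_kinf_gl (V ⊓ (rightTranslation (AdelicGroupData.gl n K)).fixedPoints U)
    (inf_le_left.trans hVA) _ hρ
  refine (exists_finiteDimensional_forall_intertwiningMap_mem_gl_of_character hHC hU hVst J hJfin hVJ _ hρ τ).elim
    fun A h ↦ ?_
  haveI := h.1
  exact Representation.finiteDimensional_intertwiningMap_of_surjective Φ hΦ A h.2

/-- **Automorphic representations of `GL_n(𝔸_K)` are admissible (Borel–Jacquet 1979, 4.5 and 4.6),
granted the CHARACTER form `harishChandra_finiteness_gl hcpt` of Harish-Chandra's finiteness theorem**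
(Borel–Jacquet 1979, 4.3 (i), for forms with a given `Z(𝔤)`-character; `AutomorphicRepsGL`). Since the
ideal form `harishChandra_finiteness hcpt` implies the character form
(`harishChandra_finiteness_gl_of_harishChandra_finiteness`, `LangAutomorphicFormsProofs`), this
sharpens `automorphicRep_isAdmissible_of_harishChandra_finiteness`: the discharge of
`automorphicRep_isAdmissible` waits only on the weaker of the two named forms of Borel–Jacquet 4.3 (i)
carried by the tree. [cite: BorelJacquet1979, 4.5 and 4.6] -/
theorem automorphicRep_isAdmissible_of_harishChandra_finiteness_gl (hHC : harishChandra_finiteness_gl hcpt) :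
    automorphicRep_isAdmissible hcpt := fun π ↦
  ⟨π.isSmooth_finiteRep_gl, fun _ hU ↦ π.isAdmissibleGK_kRepFixed_gl_of_harishChandra_finiteness_gl hHC hU⟩

end AssemblyCharacter

end Literature.NumberTheory.Automorphic
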